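/-
Copyright: lit-balaban cell, Phase-2 proof seat p24 (gen 26).  Released under Apache 2.0 license as described in the
file LICENSE.
-/
import Literature.MathematicalPhysics.QuantumFieldTheory.Balaban1983to89.B4Lemma22ZeroLatticeLpLq
import Literature.MathematicalPhysics.QuantumFieldTheory.Balaban1983to89.B4Thm110ZeroLattice

/-!
# `Balaban1983to89.B4Lemma22ZeroLatticeLpOperators` — [Balaban1983RegularityDecay] Lemma 2.2 (2.17) FOR `□ ↦` THE WHOLE
# LATTICE `ηℤ^{d+1}`, `A = 0`, AS OPERATOR STATEMENTS ON ALL OF `ℓ^p(ηℤ^{d+1})`: for EVERY datum `f` with `Σ|f|^p < ∞`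
# (not only finitely supported) the series `G_k(0)f`, `∂^η_μG_k(0)f`, `G_k(0)∂^{η*}_μf` converge absolutely, lie in `ℓ^q`,
# and obey `‖·‖_q ≤ c₂‖f‖_p` over the printed parallelogram — «bounded operators from L^p(□) … to L^q(□)» (p. 583)

statement-level skeleton of published theorems with citation tags; proofs where landed; nothing here is a claim about
the Yang–Mills mass gap

CITATION HEADER.  T. Bałaban, *Regularity and decay of lattice Green's functions*, Commun. Math. Phys. **89** (1983)
571–597, doi:10.1007/bf01214744 [Balaban1983RegularityDecay] (cell paper B4; held text
`paper:balaban1983-cmp89-regularity-decay`, journal page = PDF page + 570): p. 572 [PDF 2] (1.6), p. 577–578 [PDF 7–8]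
Lemma 2.2 (2.17) with the norms (2.11), p. 583 [PDF 13] the proof paragraph of (2.17) («bounded operators from L^{p₁}(□)
with p₁ > d to L^∞(□)», «bounded operators from L¹(□) to L^{p′₁}(□)», the figure), p. 584 [PDF 14] «valid for all such
sets»; [Balaban1983Higgs3] p. 433 (the propagator `G_k(0)` on `ηℤ^{d+1}`).  Unit `lit-balaban-p24` gen 26; HOME
`run/shared/lean/pub/lit-balaban/`; SKELETON row **B4.Lem2.2** (owner r01) — cells only, proved-headed.  Extends — by name,
nothing restated — the gen-25 finite-truncation theorems of `B4Lemma22ZeroLatticeLpLq` (off the diagonal, `q = ∞`, the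
corner `p = q = ∞`; its HONEST SCOPE (ii) «data are finitely supported» is what this file removes) with the row facts of
`B4Thm110ZeroLattice` ((1.10) value clause: rows of `G_k(0)` in `ℓ¹ ∩ ℓ^∞`).

WHAT IS PRINTED.  p. 578, Lemma 2.2: «… and a constant c₂ depending on d, p₁, such that ‖G_k(□,Ã)f‖_q,
‖D^η_{Ã,μ}G_k(□,Ã)f‖_q, ‖G_k(□,Ã)D^{η*}_{Ã,μ}f‖_q ≦ c₂‖f‖_p (2.17) for 1 ≦ p, q ≦ ∞, satisfying the condition
1/p − 1/p₁ ≦ 1/q ≦ 1/p with p₁ > d.»  p. 583: «Now we will prove that the operators G_k(□), ∂^η_μG_k(□), G_k(□)∂^{η*}_μ are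
bounded operators from L^{p₁}(□) with p₁ > d to L^∞(□). … Again by the duality argument we get that the operator G_k(□)
and its first order derivatives are bounded operators from L¹(□) to L^{p′₁}(□), p′₁^{−1} + p₁^{−1} = 1. The Riesz-Thorin
Theorem gives us finally (2.17) for G_k(□) and for all p, q described in the figure.»  p. 584: «This part of the argument is
valid for an arbitrary rectangular parallelepiped □ built of unit blocks, so the inequalities are valid for all such sets.»
On a finite `□` every `f` is finitely supported and `L^p(□)` is all functions; on `□ ↦ ηℤ^{d+1}` (the reading of this
lineage, [Balaban1983Higgs3] p. 433) the printed words «bounded operators from L^p to L^q» acquire content beyond finitely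
supported data: the operator must be defined on, and bounded on, ALL of `ℓ^p(ηℤ^{d+1})`.  That is this file.

WHAT THIS MODULE PROVES (kernel-checked; theorems only; 0 `def`; 0 `sorry`; axioms standard), in the units of the
zero-field lineage (`n = L^k = η^{−1}`, `L = ℓ + 1 ≥ 2`, window `a ∈ [a₋,a₊]`, `m² ∈ [0,m²₊]`, `G_k(0) = B3GkZeroLattice.GkLat`,
the three kernels `K^{(0)}(x,x′) = G_k(0)(x,x′)`, `K^{(1)}(x,x′) = n(G_k(0)(x+e_μ,x′) − G_k(0)(x,x′))` (`∂^η_μG_k(0)`),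
`K^{(2)}(x,x′) = n(G_k(0)(x,x′+e_μ) − G_k(0)(x,x′))` (`G_k(0)∂^{η*}_μ`), exponents `s = 1/p`, `t = 1/q`, the `η`-weighted
norms of (2.11) `‖f‖_p = (η^{d+1}Σ|f|^p)^{1/p}`, real data):
* §0 GENERIC KERNEL-EXTENSION LEMMAS ([folklore], any index type, scalars `ℝ` or `ℂ`; public, for re-use by the sibling
  finite-truncation files of the lineage): `summable_row_mul_of_lp` (a row in `ℓ¹ ∩ ℓ^∞` against `ℓ^p` data converges
  absolutely, by the majorant `‖K‖‖f‖ ≤ ‖K‖ + M‖f‖^p`), `window_bound_of_truncations` ∕ `lpq_bound_of_truncations`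
  (a uniform weighted `ℓ^p → ℓ^q` bound over all finite supports `S` and windows `Λ` passes to the full series on all of
  `ℓ^p`: truncations `S ↑` along `Finset.atTop`, Fatou by windows), `point_bound_of_truncations` (`q = ∞`),
  `sup_bound_of_truncations` (`p = q = ∞`), `tsum_rpow_le_of_windows`, `row_diff_summable_bounded`,
  `row_comp_equiv_summable`.
* §1 THE ROWS OF THE THREE KERNELS ARE IN `ℓ¹ ∩ ℓ^∞` (`rows_summable_bounded`): from `B4Thm110ZeroLattice.GkLat_weightedRow_le`
  (+ the unit shift as a bijection of `ℤ^{d+1}` for `K^{(2)}`); hence **`G_k(0)f`, `∂^η_μG_k(0)f`, `G_k(0)∂^{η*}_μf` ARE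
  DEFINED (absolutely convergent) AT EVERY POINT FOR EVERY `f ∈ ℓ^p`, `1 ≤ p < ∞`** (`GkLat_apply_summable_of_lp`) and for
  every bounded `f` (`GkLat_apply_summable_of_bounded`) — «G_k(□) … are bounded operators from L^p(□)», the domain half.
* §2 **(2.17) ON ALL OF `ℓ^p(ηℤ^{d+1})`, `1 ≤ p ≤ q < ∞`, `1/p − 1/q ≤ 1/p₁`, `p₁ > d + 1`, ALL THREE OPERATORS**
  (`GkLat_lpq_le_of_lp`, `GkLatD_lpq_le_of_lp`, `GkLatDadj_lpq_le_of_lp`): with THE SAME constant `c₂(d, L, window, p₁)` as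
  `B4Lemma22ZeroLatticeLpLq.GkLat_lpq_le` etc., for every `f : ℤ^{d+1} → ℝ` with `Σ_{x′}|f(x′)|^{1/s} < ∞`:
  `x ↦ |(K^{(m)}f)(x)|^{1/t}` is summable over the lattice and
  `(η^{d+1}Σ_x|Σ_{x′}K^{(m)}(x,x′)f(x′)|^{1/t})^t ≤ c₂(η^{d+1}Σ_{x′}|f(x′)|^{1/s})^s` — `‖K^{(m)}f‖_q ≤ c₂‖f‖_p`; the diagonal
  `q = p` is the case `t = s`.
* §3 **`q = ∞`, `p ≥ p₁` — (2.41) ON ALL OF `ℓ^p`** (`GkLat_sup_lp_le_of_lp`, `GkLatD_sup_lp_le_of_lp`,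
  `GkLatDadj_sup_lp_le_of_lp`): `|(K^{(m)}f)(x)| ≤ c₂(η^{d+1}Σ_{x′}|f(x′)|^{1/s})^s` at every point, `0 < s ≤ 1/p₁`; and the
  corner **`p = q = ∞` ON ALL BOUNDED `f`** (`GkLat_three_sup_le_of_bounded`): `|(K^{(m)}f)(x)| ≤ c₂‖f‖_∞`, `m = 0, 1, 2`.
* §4 THE `lp` DICTIONARY (`memℓp_GkLat_apply`): in Mathlib's `Memℓp` vocabulary, `f ∈ ℓ^p ⇒ G_k(0)f ∈ ℓ^q` for the three
  operators (the summability clauses of §2 read through `memℓp_gen_iff`).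
* §4b **THE THREE OPERATORS AS CONTINUOUS LINEAR MAPS `ℓ^P(ℤ^{d+1}) →L[ℝ] ℓ^Q(ℤ^{d+1})` OF NORM `≤ c₂`** on Mathlib's `lp`
  spaces (`GkLat_continuousLinearMap`, `GkLatD_continuousLinearMap`, `GkLatDadj_continuousLinearMap`): for all `ℝ≥0∞`
  exponents `1 ≤ P ≤ Q < ∞` with `1/P − 1/p₁ ≤ 1/Q` there is `T : ℓ^P →L[ℝ] ℓ^Q` with `(Tf)(x) = Σ_{x′}K^{(m)}(x,x′)f(x′)` and
  `‖T‖ ≤ c₂`, uniformly in `k ≥ 1` and the window — the printed words «bounded operators from L^p(□) … to L^q(□)» as an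
  object (unweighted `lp` norms: the `η`-weights only improve the constant by `η^{(d+1)(1/p−1/q)} ≤ 1`, `unweight_rpow`).
* §5 non-vacuity (`d + 1 = 4`, `L = 2`, `p₁ = 5`, `(p,q) = (1,5/4)`; a datum in `ℓ¹` that is NOT finitely supported).

DICTIONARY / HONEST SCOPE.  (i) `A = 0` (`Ã = 0`), one component, `□ ↦ ηℤ^{d+1}` (the lineage's reading through the
infinite-volume limit of Neumann cubes; p. 584 «valid for all such sets»); sup-norm geometry; constants existential (also on
`L` and the window).  (ii) Real-valued data, as in `B4Lemma22ZeroLatticeLpLq` (the kernels are real; complex data follow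
componentwise at the cost of a factor, not spelled out); the diagonal for complex data with the Schur constant `c₀` is
`B4Lemma22ZeroLattice.GkLat_apply_lp_le` (finitely supported) and extends by §0 verbatim — not restated here.  (iii) `p < ∞`
throughout §2–§4b (`s > 0`; `Q < ∞` in §4b); `p = ∞` data are the bounded fields of §3's corner and of
`B4Eq16ZeroLatticeBounded`.  (iv) The operator is the absolutely convergent kernel series `x ↦ Σ_{x′}K^{(m)}(x,x′)f(x′)`; §4b
packages it EXISTENTIALLY (`∃ T : ℓ^P →L[ℝ] ℓ^Q` with its action identified pointwise and `‖T‖ ≤ c₂`; no `def`) in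
UNWEIGHTED `lp` norms — the `η`-weighted inequality of (2.11) is §2.  (v) The derivative-kernel DIAGONALS with Schur constants
(r01's `B4Lemma22ZeroLatticeDeriv`, in flight at the time of writing) are not used; they extend by `lpq_bound_of_truncations`
the same way.  (vi) Value = the operator reading of (2.17) on the infinite lattice for all `ℓ^p` data; cells only on
B4.Lem2.2; NOT summit progress.
-/

namespace Literature.MathematicalPhysics.QuantumFieldTheory.Balaban1983to89.B4Lemma22ZeroLatticeLpOperators

open Finset Filter Topology
open Literature.MathematicalPhysics.QuantumFieldTheory.Balaban1983to89.B4ContourShift (supNorm supNorm_nonneg)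
open Literature.MathematicalPhysics.QuantumFieldTheory.Balaban1983to89.B3GkZeroLattice (GkLat GkLat_comm)
open Literature.MathematicalPhysics.QuantumFieldTheory.Balaban1983to89.B4Thm110ZeroLattice (GkLat_weightedRow_le
  GkLat_row_summable GkLat_abs_le)
open Literature.MathematicalPhysics.QuantumFieldTheory.Balaban1983to89.B4Lemma22ZeroLatticeLpLq (GkLat_lpq_le GkLatD_lpq_le
  GkLatDadj_lpq_le GkLat_sup_lp_le GkLatD_sup_lp_le GkLatDadj_sup_lp_le GkLat_three_sup_le)

noncomputable section

/-! ## §0 Generic kernel-extension lemmas ([folklore]; any index type `X`, scalars `𝕜 = ℝ` or `ℂ`) -/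

section Generic

variable {X 𝕜 : Type*} [RCLike 𝕜]

/-- kernel: `t ≤ 1 + t^p` for `t ≥ 0` and `p ≥ 1`. [cite: Balaban1983RegularityDecay, proof of Lemma 2.2 p.583 («bounded operators from L^p(□) … to L^q(□)») — generic extension step, folklore analysis] -/
theorem le_one_add_rpow {t p : ℝ} (ht : 0 ≤ t) (hp : 1 ≤ p) : t ≤ 1 + t ^ p := by
  rcases le_or_gt t 1 with h | h
  · linarith [Real.rpow_nonneg ht p]
  · have h1 : t ^ (1 : ℝ) ≤ t ^ p := Real.rpow_le_rpow_of_exponent_le h.le hp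
    rw [Real.rpow_one] at h1
    linarith

/-- **GENERIC: ABSOLUTE CONVERGENCE OF A KERNEL ROW AGAINST `ℓ^p` DATA.**  If a row `z ↦ K(z)` is summable in norm and
bounded, `‖K(z)‖ ≤ M`, then for every `f` with `Σ_z‖f(z)‖^p < ∞` (`p ≥ 1` real) the series `Σ_z K(z)f(z)` converges
absolutely — by the elementary majorant `‖K‖‖f‖ ≤ ‖K‖ + M‖f‖^p` (`t ≤ 1 + t^p`); no Hölder exponent bookkeeping. [cite: Balaban1983RegularityDecay, proof of Lemma 2.2 p.583 («bounded operators from L^p(□) … to L^q(□)») — generic extension step, folklore analysis] -/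
theorem summable_row_mul_of_lp {K f : X → 𝕜} {M p : ℝ} (hK : Summable fun z => ‖K z‖) (hM : ∀ z, ‖K z‖ ≤ M)
    (hp : 1 ≤ p) (hf : Summable fun z => ‖f z‖ ^ p) : Summable fun z => K z * f z := by
  have hmaj : ∀ z, ‖K z * f z‖ ≤ ‖K z‖ + M * ‖f z‖ ^ p := by
    intro z
    rw [norm_mul]
    calc ‖K z‖ * ‖f z‖ ≤ ‖K z‖ * (1 + ‖f z‖ ^ p) :=
          mul_le_mul_of_nonneg_left (le_one_add_rpow (norm_nonneg _) hp) (norm_nonneg _)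
      _ = ‖K z‖ + ‖K z‖ * ‖f z‖ ^ p := by ring
      _ ≤ ‖K z‖ + M * ‖f z‖ ^ p := by
          have := mul_le_mul_of_nonneg_right (hM z) (Real.rpow_nonneg (norm_nonneg (f z)) p)
          linarith
  exact Summable.of_norm_bounded (hK.add (hf.mul_left M)) hmaj

/-- **GENERIC: ABSOLUTE CONVERGENCE AGAINST BOUNDED DATA.**  A row summable in norm against `f` with `‖f(z)‖ ≤ F_∞`:
`Σ_z K(z)f(z)` converges absolutely. [cite: Balaban1983RegularityDecay, proof of Lemma 2.2 p.583 («bounded operators from L^p(□) … to L^q(□)») — generic extension step, folklore analysis] -/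
theorem summable_row_mul_of_bounded {K f : X → 𝕜} {Fsup : ℝ} (hK : Summable fun z => ‖K z‖)
    (hf : ∀ z, ‖f z‖ ≤ Fsup) : Summable fun z => K z * f z := by
  have hmaj : ∀ z, ‖K z * f z‖ ≤ ‖K z‖ * Fsup := fun z => by
    rw [norm_mul]
    exact mul_le_mul_of_nonneg_left (hf z) (norm_nonneg _)
  exact Summable.of_norm_bounded (hK.mul_right Fsup) hmaj

/-- kernel: the finite truncations `Σ_{z∈S}K(z)f(z)` tend to the series along `Finset.atTop` (the definition of the sum),
and so do their norms raised to a power `q ≥ 0`. [cite: Balaban1983RegularityDecay, proof of Lemma 2.2 p.583 («bounded operators from L^p(□) … to L^q(□)») — generic extension step, folklore analysis] -/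
theorem tendsto_norm_partial_rpow {K f : X → 𝕜} (hs : Summable fun z => K z * f z) {q : ℝ} (hq : 0 ≤ q) :
    Tendsto (fun S : Finset X => ‖∑ z ∈ S, K z * f z‖ ^ q) atTop (𝓝 (‖∑' z, K z * f z‖ ^ q)) := by
  have h : Tendsto (fun S : Finset X => ∑ z ∈ S, K z * f z) atTop (𝓝 (∑' z, K z * f z)) := hs.hasSum
  exact h.norm.rpow_const (Or.inr hq)

/-- kernel: a truncated `ℓ^p` mass is below the full one, after the weight `w ≥ 0`, the power `s ≥ 0` and a factor
`c ≥ 0`: `c(wΣ_{z∈S}‖f(z)‖^p)^s ≤ c(wΣ_z‖f(z)‖^p)^s`. [cite: Balaban1983RegularityDecay, proof of Lemma 2.2 p.583 («bounded operators from L^p(□) … to L^q(□)») — generic extension step, folklore analysis] -/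
theorem rhs_truncation_le {f : X → 𝕜} {p w s c : ℝ} (hf : Summable fun z => ‖f z‖ ^ p) (hw : 0 ≤ w) (hs : 0 ≤ s)
    (hc : 0 ≤ c) (S : Finset X) :
    c * (w * ∑ z ∈ S, ‖f z‖ ^ p) ^ s ≤ c * (w * ∑' z, ‖f z‖ ^ p) ^ s := by
  have h1 : ∑ z ∈ S, ‖f z‖ ^ p ≤ ∑' z, ‖f z‖ ^ p :=
    hf.sum_le_tsum S fun z _ => Real.rpow_nonneg (norm_nonneg _) _
  have h0 : 0 ≤ w * ∑ z ∈ S, ‖f z‖ ^ p := mul_nonneg hw (Finset.sum_nonneg fun z _ => Real.rpow_nonneg (norm_nonneg _) _)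
  exact mul_le_mul_of_nonneg_left (Real.rpow_le_rpow h0 (mul_le_mul_of_nonneg_left h1 hw) hs) hc

/-- **GENERIC: FROM FINITE TRUNCATIONS TO ALL OF `ℓ^p`, WINDOW FORM (Fatou along `S ↑ X`).**  Let the kernel `K` act on
data supported in finite sets `S` with a uniform weighted `ℓ^p → ℓ^q` bound on a finite output window `Λ`:
`(wΣ_{x∈Λ}‖Σ_{z∈S}K(x,z)f(z)‖^q)^t ≤ c(wΣ_{z∈S}‖f(z)‖^p)^s` for ALL finite `S`.  If every row series `Σ_zK(x,z)f(z)`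
converges and `Σ_z‖f(z)‖^p < ∞`, then the same bound holds for the full series on that window:
`(wΣ_{x∈Λ}‖Σ_zK(x,z)f(z)‖^q)^t ≤ c(wΣ_z‖f(z)‖^p)^s` (`w, s, t, q, c ≥ 0`). [cite: Balaban1983RegularityDecay, proof of Lemma 2.2 p.583 («bounded operators from L^p(□) … to L^q(□)») — generic extension step, folklore analysis] -/
theorem window_bound_of_truncations {K : X → X → 𝕜} {f : X → 𝕜} {p q w s t c : ℝ} (hw : 0 ≤ w) (hs : 0 ≤ s)
    (ht : 0 ≤ t) (hq : 0 ≤ q) (hc : 0 ≤ c) (hf : Summable fun z => ‖f z‖ ^ p)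
    (hrow : ∀ x, Summable fun z => K x z * f z) (Λ : Finset X)
    (hb : ∀ S : Finset X,
      (w * ∑ x ∈ Λ, ‖∑ z ∈ S, K x z * f z‖ ^ q) ^ t ≤ c * (w * ∑ z ∈ S, ‖f z‖ ^ p) ^ s) :
    (w * ∑ x ∈ Λ, ‖∑' z, K x z * f z‖ ^ q) ^ t ≤ c * (w * ∑' z, ‖f z‖ ^ p) ^ s := by
  have hlim : Tendsto (fun S : Finset X => (w * ∑ x ∈ Λ, ‖∑ z ∈ S, K x z * f z‖ ^ q) ^ t) atTop
      (𝓝 ((w * ∑ x ∈ Λ, ‖∑' z, K x z * f z‖ ^ q) ^ t)) := by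
    refine ((tendsto_finsetSum Λ fun x _ => tendsto_norm_partial_rpow (hrow x) hq).const_mul w).rpow_const (Or.inr ht)
  exact le_of_tendsto' hlim fun S => (hb S).trans (rhs_truncation_le hf hw hs hc S)

/-- **GENERIC: POINT FORM (`q = ∞`).**  A uniform bound `‖Σ_{z∈S}K(z)f(z)‖ ≤ c(wΣ_{z∈S}‖f(z)‖^p)^s` over all finite `S`
passes to the full series: `‖Σ_zK(z)f(z)‖ ≤ c(wΣ_z‖f(z)‖^p)^s`. [cite: Balaban1983RegularityDecay, proof of Lemma 2.2 p.583 («bounded operators from L^p(□) … to L^q(□)») — generic extension step, folklore analysis] -/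
theorem point_bound_of_truncations {K f : X → 𝕜} {p w s c : ℝ} (hw : 0 ≤ w) (hs : 0 ≤ s) (hc : 0 ≤ c)
    (hf : Summable fun z => ‖f z‖ ^ p) (hrow : Summable fun z => K z * f z)
    (hb : ∀ S : Finset X, ‖∑ z ∈ S, K z * f z‖ ≤ c * (w * ∑ z ∈ S, ‖f z‖ ^ p) ^ s) :
    ‖∑' z, K z * f z‖ ≤ c * (w * ∑' z, ‖f z‖ ^ p) ^ s := by
  have hlim := tendsto_norm_partial_rpow (q := 1) hrow zero_le_one
  simp only [Real.rpow_one] at hlim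
  exact le_of_tendsto' hlim fun S => (hb S).trans (rhs_truncation_le hf hw hs hc S)

/-- **GENERIC: SUP FORM (`p = q = ∞`).**  A uniform bound `‖Σ_{z∈S}K(z)f(z)‖ ≤ B` over all finite `S` passes to the full
series. [cite: Balaban1983RegularityDecay, proof of Lemma 2.2 p.583 («bounded operators from L^p(□) … to L^q(□)») — generic extension step, folklore analysis] -/
theorem sup_bound_of_truncations {K f : X → 𝕜} {B : ℝ} (hrow : Summable fun z => K z * f z)
    (hb : ∀ S : Finset X, ‖∑ z ∈ S, K z * f z‖ ≤ B) : ‖∑' z, K z * f z‖ ≤ B := by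
  have hlim := tendsto_norm_partial_rpow (q := 1) hrow zero_le_one
  simp only [Real.rpow_one] at hlim
  exact le_of_tendsto' hlim hb

/-- **GENERIC: FROM WINDOWS TO THE WHOLE-SPACE SERIES.**  A uniform bound `(w·Σ_{x∈Λ}u(x))^t ≤ B` over all finite windows
(`u ≥ 0`, `w > 0`, `t > 0`, `B ≥ 0`) gives the convergence of `Σ_x u(x)` and `(w·Σ_x u(x))^t ≤ B`. [cite: Balaban1983RegularityDecay, proof of Lemma 2.2 p.583 («bounded operators from L^p(□) … to L^q(□)») — generic extension step, folklore analysis] -/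
theorem tsum_rpow_le_of_windows {u : X → ℝ} (hu : ∀ x, 0 ≤ u x) {w t B : ℝ} (hw : 0 < w) (ht : 0 < t) (hB : 0 ≤ B)
    (h : ∀ Λ : Finset X, (w * ∑ x ∈ Λ, u x) ^ t ≤ B) :
    Summable u ∧ (w * ∑' x, u x) ^ t ≤ B := by
  have hfin : ∀ Λ : Finset X, ∑ x ∈ Λ, u x ≤ B ^ t⁻¹ / w := by
    intro Λ
    have h0 : 0 ≤ w * ∑ x ∈ Λ, u x := mul_nonneg hw.le (Finset.sum_nonneg fun x _ => hu x)
    have h1 : w * ∑ x ∈ Λ, u x ≤ B ^ t⁻¹ := by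
      have := Real.rpow_le_rpow (Real.rpow_nonneg h0 t) (h Λ) (inv_nonneg.2 ht.le)
      rwa [Real.rpow_rpow_inv h0 ht.ne'] at this
    rw [le_div_iff₀ hw]
    linarith
  have hsum : Summable u := summable_of_sum_le hu hfin
  refine ⟨hsum, ?_⟩
  have htsum : ∑' x, u x ≤ B ^ t⁻¹ / w := Real.tsum_le_of_sum_le hu hfin
  have h2 : w * ∑' x, u x ≤ B ^ t⁻¹ := by rwa [le_div_iff₀ hw, mul_comm] at htsum
  have h0 : 0 ≤ w * ∑' x, u x := mul_nonneg hw.le (tsum_nonneg hu)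
  calc (w * ∑' x, u x) ^ t ≤ (B ^ t⁻¹) ^ t := Real.rpow_le_rpow h0 h2 ht.le
    _ = B := Real.rpow_inv_rpow hB ht.ne'

/-- **GENERIC: THE FULL `ℓ^p → ℓ^q` EXTENSION.**  Under the hypotheses of `window_bound_of_truncations` for every window,
with `w, t > 0`: `x ↦ ‖Σ_zK(x,z)f(z)‖^q` is summable over `X` and `(wΣ_x‖Σ_zK(x,z)f(z)‖^q)^t ≤ c(wΣ_z‖f(z)‖^p)^s`.
[cite: Balaban1983RegularityDecay, proof of Lemma 2.2 p.583 («bounded operators from L^p(□) … to L^q(□)») — generic extension step, folklore analysis] -/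
theorem lpq_bound_of_truncations {K : X → X → 𝕜} {f : X → 𝕜} {p q w s t c : ℝ} (hw : 0 < w) (hs : 0 ≤ s)
    (ht : 0 < t) (hq : 0 ≤ q) (hc : 0 ≤ c) (hf : Summable fun z => ‖f z‖ ^ p)
    (hrow : ∀ x, Summable fun z => K x z * f z)
    (hb : ∀ S Λ : Finset X,
      (w * ∑ x ∈ Λ, ‖∑ z ∈ S, K x z * f z‖ ^ q) ^ t ≤ c * (w * ∑ z ∈ S, ‖f z‖ ^ p) ^ s) :
    (Summable fun x => ‖∑' z, K x z * f z‖ ^ q) ∧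
      (w * ∑' x, ‖∑' z, K x z * f z‖ ^ q) ^ t ≤ c * (w * ∑' z, ‖f z‖ ^ p) ^ s :=
  tsum_rpow_le_of_windows (fun _ => Real.rpow_nonneg (norm_nonneg _) _) hw ht
    (mul_nonneg hc (Real.rpow_nonneg (mul_nonneg hw.le (tsum_nonneg fun _ => Real.rpow_nonneg (norm_nonneg _) _)) _))
    fun Λ => window_bound_of_truncations hw.le hs ht.le hq hc hf hrow Λ fun S => hb S Λ

/-- **GENERIC: ROWS IN `ℓ¹ ∩ ℓ^∞` ARE STABLE UNDER DIFFERENCES** — the form in which the derivative kernels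
`n(K(x+e,·) − K(x,·))` and `n(K(x,·+e) − K(x,·))` inherit absolute row convergence: if `z ↦ ‖K₁(z)‖` and `z ↦ ‖K₂(z)‖` are
summable and bounded by `M`, then `z ↦ ‖c(K₁(z) − K₂(z))‖` is summable and bounded by `‖c‖·2M`. [cite: Balaban1983RegularityDecay, proof of Lemma 2.2 p.583 («bounded operators from L^p(□) … to L^q(□)») — generic extension step, folklore analysis] -/
theorem row_diff_summable_bounded {K₁ K₂ : X → 𝕜} {M : ℝ} (c : 𝕜) (h₁ : Summable fun z => ‖K₁ z‖)
    (h₂ : Summable fun z => ‖K₂ z‖) (hM₁ : ∀ z, ‖K₁ z‖ ≤ M) (hM₂ : ∀ z, ‖K₂ z‖ ≤ M) :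
    (Summable fun z => ‖c * (K₁ z - K₂ z)‖) ∧ ∀ z, ‖c * (K₁ z - K₂ z)‖ ≤ ‖c‖ * (2 * M) := by
  refine ⟨Summable.of_nonneg_of_le (fun _ => norm_nonneg _) (fun z => ?_) ((h₁.add h₂).mul_left ‖c‖), fun z => ?_⟩
  · rw [norm_mul]
    exact mul_le_mul_of_nonneg_left (norm_sub_le _ _) (norm_nonneg _)
  · rw [norm_mul]
    refine mul_le_mul_of_nonneg_left ((norm_sub_le _ _).trans ?_) (norm_nonneg _)
    linarith [hM₁ z, hM₂ z]

/-- kernel: a row composed with a bijection of the index set (e.g. the unit shift `z ↦ z + e_μ`) stays summable in norm.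
[cite: Balaban1983RegularityDecay, proof of Lemma 2.2 p.583 («bounded operators from L^p(□) … to L^q(□)») — generic extension step, folklore analysis] -/
theorem row_comp_equiv_summable {K : X → 𝕜} (e : X ≃ X) (h : Summable fun z => ‖K z‖) :
    Summable fun z => ‖K (e z)‖ :=
  (e.summable_iff (f := fun z => ‖K z‖)).2 h

end Generic

/-! ## §1 The rows of `G_k(0)`, `∂^η_μG_k(0)`, `G_k(0)∂^{η*}_μ` on `ηℤ^{d+1}` lie in `ℓ¹ ∩ ℓ^∞`; the three operators are
defined on all of `ℓ^p` -/

section Rows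

variable {d : ℕ}

/-- **THE ROWS OF THE THREE KERNELS ARE SUMMABLE AND BOUNDED, UNIFORMLY ON THE WINDOW**: there is `c₀ > 0` (on `d`, `L`,
the window) such that for every `k ≥ 1`, `a ∈ [a₋,a₊]`, `m² ∈ [0,m²₊]`, every axis `μ` and every row `x`, each of
`z ↦ G_k(0)(x,z)`, `z ↦ n(G_k(0)(x+e_μ,z) − G_k(0)(x,z))`, `z ↦ n(G_k(0)(x,z+e_μ) − G_k(0)(x,z))` is absolutely summable
over `ℤ^{d+1}` with every entry bounded by `c₀`, resp. `2nc₀` — the value clause of (1.10) on the lattice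
(`B4Thm110ZeroLattice.GkLat_weightedRow_le`: `Σ_z|G_k(0)(x,z)|e^{δ₀|x−z|_∞/n} ≤ c₀`).
[cite: Balaban1983RegularityDecay, Theorem (1.10) p.573, Lemma 2.2 (2.17) p.578 at p = q = ∞; dictionary (□ ↦ ηℤ^{d+1}, A = 0)] -/
theorem rows_summable_bounded (d ℓ : ℕ) (hℓ : 1 ≤ ℓ) (amin aplus m2plus : ℝ) (ha : 0 < amin) :
    ∃ c₀ : ℝ, 0 < c₀ ∧ ∀ (k : ℕ), 1 ≤ k → ∀ (a m2 : ℝ), amin ≤ a → a ≤ aplus → 0 ≤ m2 → m2 ≤ m2plus →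
      ∀ (μ : Fin (d + 1)) (x : Fin (d + 1) → ℤ),
        ((Summable fun z => ‖GkLat ℓ k a m2 x z‖) ∧ ∀ z, ‖GkLat ℓ k a m2 x z‖ ≤ c₀) ∧
        ((Summable fun z => ‖(((ℓ + 1) ^ k : ℕ) : ℝ) * (GkLat ℓ k a m2 (x + Pi.single μ 1) z - GkLat ℓ k a m2 x z)‖) ∧
          ∀ z, ‖(((ℓ + 1) ^ k : ℕ) : ℝ) * (GkLat ℓ k a m2 (x + Pi.single μ 1) z - GkLat ℓ k a m2 x z)‖
            ≤ (((ℓ + 1) ^ k : ℕ) : ℝ) * (2 * c₀)) ∧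
        ((Summable fun z => ‖(((ℓ + 1) ^ k : ℕ) : ℝ) * (GkLat ℓ k a m2 x (z + Pi.single μ 1) - GkLat ℓ k a m2 x z)‖) ∧
          ∀ z, ‖(((ℓ + 1) ^ k : ℕ) : ℝ) * (GkLat ℓ k a m2 x (z + Pi.single μ 1) - GkLat ℓ k a m2 x z)‖
            ≤ (((ℓ + 1) ^ k : ℕ) : ℝ) * (2 * c₀)) := by
  obtain ⟨δ₀, c₀, hδ₀, hc₀, h⟩ := GkLat_weightedRow_le d ℓ hℓ amin aplus m2plus ha
  refine ⟨c₀, hc₀, fun k hk a m2 h1 h2 h3 h4 μ x => ?_⟩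
  -- the basic row facts at every row `y`
  have hrow : ∀ y : Fin (d + 1) → ℤ, (Summable fun z => ‖GkLat ℓ k a m2 y z‖) ∧ ∀ z, ‖GkLat ℓ k a m2 y z‖ ≤ c₀ := by
    intro y
    have hF := h k hk a m2 h1 h2 h3 h4 y
    refine ⟨((GkLat_row_summable hδ₀.le hF).1).congr fun z => (Real.norm_eq_abs _).symm, fun z => ?_⟩
    rw [Real.norm_eq_abs]
    refine (GkLat_abs_le hF z).trans ?_
    have : Real.exp (-(δ₀ * supNorm (y - z) / (((ℓ + 1) ^ k : ℕ) : ℝ))) ≤ 1 :=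
      Real.exp_le_one_iff.2 (neg_nonpos.2 (div_nonneg (mul_nonneg hδ₀.le (supNorm_nonneg _)) (Nat.cast_nonneg _)))
    calc c₀ * Real.exp (-(δ₀ * supNorm (y - z) / (((ℓ + 1) ^ k : ℕ) : ℝ))) ≤ c₀ * 1 :=
          mul_le_mul_of_nonneg_left this hc₀.le
      _ = c₀ := mul_one _
  have hn : ‖((((ℓ + 1) ^ k : ℕ) : ℝ))‖ = (((ℓ + 1) ^ k : ℕ) : ℝ) := by
    rw [Real.norm_eq_abs, abs_of_nonneg (Nat.cast_nonneg _)]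
  refine ⟨hrow x, ?_, ?_⟩
  · have H := row_diff_summable_bounded (𝕜 := ℝ) ((((ℓ + 1) ^ k : ℕ) : ℝ)) (hrow (x + Pi.single μ 1)).1 (hrow x).1
      (hrow (x + Pi.single μ 1)).2 (hrow x).2
    rw [hn] at H
    exact H
  · -- the shifted row `z ↦ G(x, z + e_μ)` is the row of `x` composed with the bijection `z ↦ z + e_μ`
    have hs : Summable fun z : Fin (d + 1) → ℤ => ‖GkLat ℓ k a m2 x (z + Pi.single μ (1 : ℤ))‖ := by
      have H0 := row_comp_equiv_summable (𝕜 := ℝ) (K := fun z => GkLat ℓ k a m2 x z)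
        (Equiv.addRight (Pi.single μ (1 : ℤ))) (hrow x).1
      simpa only [Equiv.coe_addRight] using H0
    have H := row_diff_summable_bounded (𝕜 := ℝ) ((((ℓ + 1) ^ k : ℕ) : ℝ)) hs (hrow x).1
      (fun z => (hrow x).2 (z + Pi.single μ 1)) (hrow x).2
    rw [hn] at H
    exact H

/-- **`G_k(0)f`, `∂^η_μG_k(0)f`, `G_k(0)∂^{η*}_μf` ARE DEFINED AT EVERY POINT FOR EVERY `f ∈ ℓ^p(ηℤ^{d+1})`, `1 ≤ p < ∞`**:
for `k ≥ 1`, `a > 0`, `m² ≥ 0`, every `f : ℤ^{d+1} → ℝ` with `Σ_z|f(z)|^p < ∞` (`p ≥ 1` real) and every `x`, the three series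
`Σ_z G_k(0)(x,z)f(z)`, `Σ_z n(G_k(0)(x+e_μ,z) − G_k(0)(x,z))f(z)`, `Σ_z n(G_k(0)(x,z+e_μ) − G_k(0)(x,z))f(z)` converge
absolutely — the domain half of «the operators G_k(□), ∂^η_μG_k(□), G_k(□)∂^{η*}_μ are bounded operators from L^p(□)».
[cite: Balaban1983RegularityDecay, Lemma 2.2 (2.17) p.578 with (1.6) p.572; proof p.583; dictionary (□ ↦ ηℤ^{d+1}, A = 0)] -/
theorem GkLat_apply_summable_of_lp {ℓ k : ℕ} (hℓ : 1 ≤ ℓ) (hk : 1 ≤ k) {a m2 : ℝ} (ha : 0 < a) (hm : 0 ≤ m2)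
    {p : ℝ} (hp : 1 ≤ p) {f : (Fin (d + 1) → ℤ) → ℝ} (hf : Summable fun z => |f z| ^ p) (μ : Fin (d + 1))
    (x : Fin (d + 1) → ℤ) :
    (Summable fun z => GkLat ℓ k a m2 x z * f z) ∧
    (Summable fun z => ((((ℓ + 1) ^ k : ℕ) : ℝ) * (GkLat ℓ k a m2 (x + Pi.single μ 1) z - GkLat ℓ k a m2 x z)) * f z) ∧
    (Summable fun z => ((((ℓ + 1) ^ k : ℕ) : ℝ) * (GkLat ℓ k a m2 x (z + Pi.single μ 1) - GkLat ℓ k a m2 x z)) * f z) := by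
  obtain ⟨c₀, -, h⟩ := rows_summable_bounded d ℓ hℓ a a m2 ha
  obtain ⟨⟨h0s, h0b⟩, ⟨h1s, h1b⟩, ⟨h2s, h2b⟩⟩ := h k hk a m2 le_rfl le_rfl hm le_rfl μ x
  have hf' : Summable fun z => ‖f z‖ ^ p := hf.congr fun z => by rw [Real.norm_eq_abs]
  exact ⟨summable_row_mul_of_lp h0s h0b hp hf', summable_row_mul_of_lp h1s h1b hp hf',
    summable_row_mul_of_lp h2s h2b hp hf'⟩

/-- **THE THREE OPERATORS ARE DEFINED ON ALL BOUNDED FIELDS** (`p = ∞`): for bounded `f` (`|f| ≤ F_∞`) the three series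
converge absolutely at every point (rows in `ℓ¹`).
[cite: Balaban1983RegularityDecay, Lemma 2.2 (2.17) p.578 at p = q = ∞, (1.10) p.573; dictionary (□ ↦ ηℤ^{d+1}, A = 0)] -/
theorem GkLat_apply_summable_of_bounded {ℓ k : ℕ} (hℓ : 1 ≤ ℓ) (hk : 1 ≤ k) {a m2 : ℝ} (ha : 0 < a) (hm : 0 ≤ m2)
    {f : (Fin (d + 1) → ℤ) → ℝ} {Fsup : ℝ} (hf : ∀ z, |f z| ≤ Fsup) (μ : Fin (d + 1)) (x : Fin (d + 1) → ℤ) :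
    (Summable fun z => GkLat ℓ k a m2 x z * f z) ∧
    (Summable fun z => ((((ℓ + 1) ^ k : ℕ) : ℝ) * (GkLat ℓ k a m2 (x + Pi.single μ 1) z - GkLat ℓ k a m2 x z)) * f z) ∧
    (Summable fun z => ((((ℓ + 1) ^ k : ℕ) : ℝ) * (GkLat ℓ k a m2 x (z + Pi.single μ 1) - GkLat ℓ k a m2 x z)) * f z) := by
  obtain ⟨c₀, -, h⟩ := rows_summable_bounded d ℓ hℓ a a m2 ha
  obtain ⟨⟨h0s, -⟩, ⟨h1s, -⟩, ⟨h2s, -⟩⟩ := h k hk a m2 le_rfl le_rfl hm le_rfl μ x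
  have hf' : ∀ z, ‖f z‖ ≤ Fsup := fun z => by rw [Real.norm_eq_abs]; exact hf z
  exact ⟨summable_row_mul_of_bounded h0s hf', summable_row_mul_of_bounded h1s hf', summable_row_mul_of_bounded h2s hf'⟩

end Rows

/-! ## §2 (2.17) on all of `ℓ^p(ηℤ^{d+1})`: `1 ≤ p ≤ q < ∞`, `1/p − 1/q ≤ 1/p₁`, the three operators -/

section Main

variable {d : ℕ}

/-- kernel: `1 ≤ 1/s` for `0 < s ≤ 1`. [folklore] -/
private theorem one_le_inv_exp {s : ℝ} (hs : 0 < s) (hs1 : s ≤ 1) : 1 ≤ 1 / s := by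
  rw [le_div_iff₀ hs, one_mul]; exact hs1

/-- kernel: the extension step shared by the three `q < ∞` theorems — a finite-truncation bound of the lineage's shape for a
real kernel `K` and every finite `S, Λ`, plus absolutely convergent rows, give the bound for every `f ∈ ℓ^p` on the whole
lattice. [folklore] -/
private theorem extend_lpq {K : (Fin (d + 1) → ℤ) → (Fin (d + 1) → ℤ) → ℝ} {w s t c : ℝ} (hw : 0 < w) (hs : 0 < s)
    (ht : 0 < t) (hc : 0 < c) {f : (Fin (d + 1) → ℤ) → ℝ} (hf : Summable fun z => |f z| ^ (1 / s))
    (hrow : ∀ x, Summable fun z => K x z * f z)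
    (hb : ∀ (S Λ : Finset (Fin (d + 1) → ℤ)),
      (w * ∑ x ∈ Λ, |∑ z ∈ S, K x z * f z| ^ (1 / t)) ^ t ≤ c * (w * ∑ z ∈ S, |f z| ^ (1 / s)) ^ s) :
    (Summable fun x => |∑' z, K x z * f z| ^ (1 / t)) ∧
      (w * ∑' x, |∑' z, K x z * f z| ^ (1 / t)) ^ t ≤ c * (w * ∑' z, |f z| ^ (1 / s)) ^ s := by
  have hf' : Summable fun z => ‖f z‖ ^ (1 / s) := hf.congr fun z => by rw [Real.norm_eq_abs]
  have hb' : ∀ (S Λ : Finset (Fin (d + 1) → ℤ)),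
      (w * ∑ x ∈ Λ, ‖∑ z ∈ S, K x z * f z‖ ^ (1 / t)) ^ t ≤ c * (w * ∑ z ∈ S, ‖f z‖ ^ (1 / s)) ^ s := by
    simpa only [Real.norm_eq_abs] using hb
  have H := lpq_bound_of_truncations (𝕜 := ℝ) hw hs.le ht (one_div_nonneg.2 ht.le) hc.le hf' hrow hb'
  simpa only [Real.norm_eq_abs] using H

/-- **(2.17) ON ALL OF `ℓ^p(ηℤ^{d+1})` — THE OPERATOR `G_k(0)`, ALL `1 ≤ p ≤ q < ∞` WITH `1/p − 1/q ≤ 1/p₁`, `p₁ > d + 1`.**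
There is `c₂ > 0` (depending on `d`, `L = ℓ+1`, the window and `p₁` only — the constant of
`B4Lemma22ZeroLatticeLpLq.GkLat_lpq_le`) such that for every `k ≥ 1` (`η = L^{−k}`), `a ∈ [a₋,a₊]`, `m² ∈ [0,m²₊]`, all
`0 < t ≤ s ≤ 1` with `s − 1/p₁ ≤ t`, and EVERY `f : ℤ^{d+1} → ℝ` with `Σ_{x′}|f(x′)|^{1/s} < ∞` (i.e. `f ∈ ℓ^p`, `p = 1/s`):
`x ↦ |(G_k(0)f)(x)|^{1/t}` is summable over the lattice and
`(η^{d+1}Σ_x|Σ_{x′}G_k(0)(x,x′)f(x′)|^{1/t})^t ≤ c₂(η^{d+1}Σ_{x′}|f(x′)|^{1/s})^s`, i.e. `‖G_k(0)f‖_q ≤ c₂‖f‖_p` in the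
`η`-weighted norms of (2.11) — «the operator G_k(□) … bounded … from L^p to L^q» for ALL of `L^p`, on `□ ↦ ηℤ^{d+1}`:
the finite-truncation theorem for every finite support `S`, truncations `S ↑ ℤ^{d+1}`, Fatou by windows (§0).
[cite: Balaban1983RegularityDecay, Lemma 2.2 (2.17) p.578; proof p.583 («bounded operators … The Riesz-Thorin Theorem gives us finally (2.17) … for all p, q described in the figure»); dictionary (□ ↦ ηℤ^{d+1}, A = 0, p₁ > d ↦ p₁ > d+1 = the lattice dimension)] -/
theorem GkLat_lpq_le_of_lp (d ℓ : ℕ) (hℓ : 1 ≤ ℓ) (amin aplus m2plus : ℝ) (ha : 0 < amin) (p₁ : ℝ)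
    (hp : (d : ℝ) + 1 < p₁) :
    ∃ c₂ : ℝ, 0 < c₂ ∧ ∀ (k : ℕ), 1 ≤ k → ∀ (a m2 : ℝ), amin ≤ a → a ≤ aplus → 0 ≤ m2 → m2 ≤ m2plus →
      ∀ (s t : ℝ), 0 < t → t ≤ s → s ≤ 1 → s - 1 / p₁ ≤ t →
      ∀ (f : (Fin (d + 1) → ℤ) → ℝ), (Summable fun x' => |f x'| ^ (1 / s)) →
        (∀ x, Summable fun x' => GkLat ℓ k a m2 x x' * f x') ∧
        (Summable fun x => |∑' x', GkLat ℓ k a m2 x x' * f x'| ^ (1 / t)) ∧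
        (((1 : ℝ) / ((ℓ + 1) ^ k : ℕ)) ^ (d + 1) * ∑' x, |∑' x', GkLat ℓ k a m2 x x' * f x'| ^ (1 / t)) ^ t
          ≤ c₂ * (((1 : ℝ) / ((ℓ + 1) ^ k : ℕ)) ^ (d + 1) * ∑' x', |f x'| ^ (1 / s)) ^ s := by
  obtain ⟨c₂, hc₂, h⟩ := GkLat_lpq_le d ℓ hℓ amin aplus m2plus ha p₁ hp
  refine ⟨c₂, hc₂, fun k hk a m2 h1 h2 h3 h4 s t ht hts hs1 hpt f hf => ?_⟩
  have ha0 : 0 < a := ha.trans_le h1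
  have hs : 0 < s := ht.trans_le hts
  have _i : Inhabited (Fin (d + 1)) := ⟨0⟩
  have hrow : ∀ x, Summable fun x' => GkLat ℓ k a m2 x x' * f x' := fun x =>
    (GkLat_apply_summable_of_lp hℓ hk ha0 h3 (one_le_inv_exp hs hs1) hf default x).1
  exact ⟨hrow, extend_lpq (by positivity) hs ht hc₂ hf hrow fun S Λ => h k hk a m2 h1 h2 h3 h4 s t ht hts hs1 hpt S Λ f⟩

/-- **(2.17) ON ALL OF `ℓ^p(ηℤ^{d+1})` — THE OPERATOR `∂^η_μG_k(0)`, ALL `1 ≤ p ≤ q < ∞` WITH `1/p − 1/q ≤ 1/p₁`, `p₁ > d + 1`**: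
the same for the kernel `n(G_k(0)(x+e_μ,x′) − G_k(0)(x,x′))` (fine units, `∂^η_μ = n·(shift − 1)`), every axis `μ`, every
`f ∈ ℓ^p` — the constant of `B4Lemma22ZeroLatticeLpLq.GkLatD_lpq_le`.
[cite: Balaban1983RegularityDecay, Lemma 2.2 (2.17) p.578 (second operator); proof p.583; dictionary (□ ↦ ηℤ^{d+1}, A = 0)] -/
theorem GkLatD_lpq_le_of_lp (d ℓ : ℕ) (hℓ : 1 ≤ ℓ) (amin aplus m2plus : ℝ) (ha : 0 < amin) (p₁ : ℝ)
    (hp : (d : ℝ) + 1 < p₁) :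
    ∃ c₂ : ℝ, 0 < c₂ ∧ ∀ (k : ℕ), 1 ≤ k → ∀ (a m2 : ℝ), amin ≤ a → a ≤ aplus → 0 ≤ m2 → m2 ≤ m2plus →
      ∀ (μ : Fin (d + 1)) (s t : ℝ), 0 < t → t ≤ s → s ≤ 1 → s - 1 / p₁ ≤ t →
      ∀ (f : (Fin (d + 1) → ℤ) → ℝ), (Summable fun x' => |f x'| ^ (1 / s)) →
        (∀ x, Summable fun x' => ((((ℓ + 1) ^ k : ℕ) : ℝ) *
            (GkLat ℓ k a m2 (x + Pi.single μ 1) x' - GkLat ℓ k a m2 x x')) * f x') ∧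
        (Summable fun x => |∑' x', ((((ℓ + 1) ^ k : ℕ) : ℝ) *
            (GkLat ℓ k a m2 (x + Pi.single μ 1) x' - GkLat ℓ k a m2 x x')) * f x'| ^ (1 / t)) ∧
        (((1 : ℝ) / ((ℓ + 1) ^ k : ℕ)) ^ (d + 1) * ∑' x, |∑' x', ((((ℓ + 1) ^ k : ℕ) : ℝ) *
            (GkLat ℓ k a m2 (x + Pi.single μ 1) x' - GkLat ℓ k a m2 x x')) * f x'| ^ (1 / t)) ^ t
          ≤ c₂ * (((1 : ℝ) / ((ℓ + 1) ^ k : ℕ)) ^ (d + 1) * ∑' x', |f x'| ^ (1 / s)) ^ s := by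
  obtain ⟨c₂, hc₂, h⟩ := GkLatD_lpq_le d ℓ hℓ amin aplus m2plus ha p₁ hp
  refine ⟨c₂, hc₂, fun k hk a m2 h1 h2 h3 h4 μ s t ht hts hs1 hpt f hf => ?_⟩
  have ha0 : 0 < a := ha.trans_le h1
  have hs : 0 < s := ht.trans_le hts
  have hrow : ∀ x, Summable fun x' => ((((ℓ + 1) ^ k : ℕ) : ℝ) *
      (GkLat ℓ k a m2 (x + Pi.single μ 1) x' - GkLat ℓ k a m2 x x')) * f x' := fun x =>
    (GkLat_apply_summable_of_lp hℓ hk ha0 h3 (one_le_inv_exp hs hs1) hf μ x).2.1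
  exact ⟨hrow, extend_lpq (K := fun x x' => (((ℓ + 1) ^ k : ℕ) : ℝ) *
      (GkLat ℓ k a m2 (x + Pi.single μ 1) x' - GkLat ℓ k a m2 x x')) (by positivity) hs ht hc₂ hf hrow
    fun S Λ => h k hk a m2 h1 h2 h3 h4 μ s t ht hts hs1 hpt S Λ f⟩

/-- **(2.17) ON ALL OF `ℓ^p(ηℤ^{d+1})` — THE OPERATOR `G_k(0)∂^{η*}_μ`, ALL `1 ≤ p ≤ q < ∞` WITH `1/p − 1/q ≤ 1/p₁`, `p₁ > d + 1`**:
the same for the kernel `n(G_k(0)(x,x′+e_μ) − G_k(0)(x,x′))` («by the duality argument», p. 583: the transposed kernel),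
every axis `μ`, every `f ∈ ℓ^p` — the constant of `B4Lemma22ZeroLatticeLpLq.GkLatDadj_lpq_le`.
[cite: Balaban1983RegularityDecay, Lemma 2.2 (2.17) p.578 (third operator); proof p.583; dictionary (□ ↦ ηℤ^{d+1}, A = 0)] -/
theorem GkLatDadj_lpq_le_of_lp (d ℓ : ℕ) (hℓ : 1 ≤ ℓ) (amin aplus m2plus : ℝ) (ha : 0 < amin) (p₁ : ℝ)
    (hp : (d : ℝ) + 1 < p₁) :
    ∃ c₂ : ℝ, 0 < c₂ ∧ ∀ (k : ℕ), 1 ≤ k → ∀ (a m2 : ℝ), amin ≤ a → a ≤ aplus → 0 ≤ m2 → m2 ≤ m2plus →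
      ∀ (μ : Fin (d + 1)) (s t : ℝ), 0 < t → t ≤ s → s ≤ 1 → s - 1 / p₁ ≤ t →
      ∀ (f : (Fin (d + 1) → ℤ) → ℝ), (Summable fun x' => |f x'| ^ (1 / s)) →
        (∀ x, Summable fun x' => ((((ℓ + 1) ^ k : ℕ) : ℝ) *
            (GkLat ℓ k a m2 x (x' + Pi.single μ 1) - GkLat ℓ k a m2 x x')) * f x') ∧
        (Summable fun x => |∑' x', ((((ℓ + 1) ^ k : ℕ) : ℝ) *
            (GkLat ℓ k a m2 x (x' + Pi.single μ 1) - GkLat ℓ k a m2 x x')) * f x'| ^ (1 / t)) ∧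
        (((1 : ℝ) / ((ℓ + 1) ^ k : ℕ)) ^ (d + 1) * ∑' x, |∑' x', ((((ℓ + 1) ^ k : ℕ) : ℝ) *
            (GkLat ℓ k a m2 x (x' + Pi.single μ 1) - GkLat ℓ k a m2 x x')) * f x'| ^ (1 / t)) ^ t
          ≤ c₂ * (((1 : ℝ) / ((ℓ + 1) ^ k : ℕ)) ^ (d + 1) * ∑' x', |f x'| ^ (1 / s)) ^ s := by
  obtain ⟨c₂, hc₂, h⟩ := GkLatDadj_lpq_le d ℓ hℓ amin aplus m2plus ha p₁ hp
  refine ⟨c₂, hc₂, fun k hk a m2 h1 h2 h3 h4 μ s t ht hts hs1 hpt f hf => ?_⟩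
  have ha0 : 0 < a := ha.trans_le h1
  have hs : 0 < s := ht.trans_le hts
  have hrow : ∀ x, Summable fun x' => ((((ℓ + 1) ^ k : ℕ) : ℝ) *
      (GkLat ℓ k a m2 x (x' + Pi.single μ 1) - GkLat ℓ k a m2 x x')) * f x' := fun x =>
    (GkLat_apply_summable_of_lp hℓ hk ha0 h3 (one_le_inv_exp hs hs1) hf μ x).2.2
  exact ⟨hrow, extend_lpq (K := fun x x' => (((ℓ + 1) ^ k : ℕ) : ℝ) *
      (GkLat ℓ k a m2 x (x' + Pi.single μ 1) - GkLat ℓ k a m2 x x')) (by positivity) hs ht hc₂ hf hrow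
    fun S Λ => h k hk a m2 h1 h2 h3 h4 μ s t ht hts hs1 hpt S Λ f⟩

/-! ## §3 `q = ∞`: (2.41) `L^p → L^∞` for `p ≥ p₁` on all of `ℓ^p`, and the corner `p = q = ∞` on all bounded fields -/

/-- kernel: the extension step shared by the three `q = ∞` theorems. [folklore] -/
private theorem extend_sup {K : (Fin (d + 1) → ℤ) → ℝ} {w s c : ℝ} (hw : 0 < w) (hs : 0 < s) (hc : 0 < c)
    {f : (Fin (d + 1) → ℤ) → ℝ} (hf : Summable fun z => |f z| ^ (1 / s)) (hrow : Summable fun z => K z * f z)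
    (hb : ∀ S : Finset (Fin (d + 1) → ℤ), |∑ z ∈ S, K z * f z| ≤ c * (w * ∑ z ∈ S, |f z| ^ (1 / s)) ^ s) :
    |∑' z, K z * f z| ≤ c * (w * ∑' z, |f z| ^ (1 / s)) ^ s := by
  have hf' : Summable fun z => ‖f z‖ ^ (1 / s) := hf.congr fun z => by rw [Real.norm_eq_abs]
  have hb' : ∀ S : Finset (Fin (d + 1) → ℤ), ‖∑ z ∈ S, K z * f z‖ ≤ c * (w * ∑ z ∈ S, ‖f z‖ ^ (1 / s)) ^ s := by
    simpa only [Real.norm_eq_abs] using hb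
  have H := point_bound_of_truncations (𝕜 := ℝ) hw.le hs.le hc.le hf' hrow hb'
  simpa only [Real.norm_eq_abs] using H

/-- **(2.41) ON ALL OF `ℓ^p(ηℤ^{d+1})`, THE OPERATOR `G_k(0)`** (`q = ∞`, `p ≥ p₁ > d + 1`): there is `c₂ > 0` (on `d`, `L`, the
window, `p₁`; the constant of `B4Lemma22ZeroLatticeLpLq.GkLat_sup_lp_le`) such that for every `k ≥ 1`, `a ∈ [a₋,a₊]`,
`m² ∈ [0,m²₊]`, `0 < s ≤ 1/p₁`, every `f : ℤ^{d+1} → ℝ` with `Σ_{x′}|f(x′)|^{1/s} < ∞` and every point `x`: the series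
`(G_k(0)f)(x)` converges absolutely and `|(G_k(0)f)(x)| ≤ c₂(η^{d+1}Σ_{x′}|f(x′)|^{1/s})^s` — «the operators G_k(□) … are
bounded operators from L^{p₁}(□) with p₁ > d to L^∞(□)» for all of `L^{p}`, `p ≥ p₁`, on the lattice.
[cite: Balaban1983RegularityDecay, (2.41) p.583 with Lemma 2.2 (2.17) p.578; dictionary (□ ↦ ηℤ^{d+1}, A = 0, p₁ > d+1)] -/
theorem GkLat_sup_lp_le_of_lp (d ℓ : ℕ) (hℓ : 1 ≤ ℓ) (amin aplus m2plus : ℝ) (ha : 0 < amin) (p₁ : ℝ)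
    (hp : (d : ℝ) + 1 < p₁) :
    ∃ c₂ : ℝ, 0 < c₂ ∧ ∀ (k : ℕ), 1 ≤ k → ∀ (a m2 : ℝ), amin ≤ a → a ≤ aplus → 0 ≤ m2 → m2 ≤ m2plus →
      ∀ (s : ℝ), 0 < s → s ≤ 1 / p₁ → ∀ (f : (Fin (d + 1) → ℤ) → ℝ), (Summable fun x' => |f x'| ^ (1 / s)) →
      ∀ (x : Fin (d + 1) → ℤ),
        (Summable fun x' => GkLat ℓ k a m2 x x' * f x') ∧
        |∑' x', GkLat ℓ k a m2 x x' * f x'|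
          ≤ c₂ * (((1 : ℝ) / ((ℓ + 1) ^ k : ℕ)) ^ (d + 1) * ∑' x', |f x'| ^ (1 / s)) ^ s := by
  obtain ⟨c₂, hc₂, h⟩ := GkLat_sup_lp_le d ℓ hℓ amin aplus m2plus ha p₁ hp
  refine ⟨c₂, hc₂, fun k hk a m2 h1 h2 h3 h4 s hs hsp f hf x => ?_⟩
  have ha0 : 0 < a := ha.trans_le h1
  have hD : (0 : ℝ) < (d : ℝ) + 1 := by positivity
  have hs1 : s ≤ 1 := hsp.trans (by rw [div_le_one (hD.trans hp)]; linarith)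
  have _i : Inhabited (Fin (d + 1)) := ⟨0⟩
  have hrow := (GkLat_apply_summable_of_lp hℓ hk ha0 h3 (one_le_inv_exp hs hs1) hf default x).1
  exact ⟨hrow, extend_sup (by positivity) hs hc₂ hf hrow fun S => h k hk a m2 h1 h2 h3 h4 s hs hsp S f x⟩

/-- **(2.41) ON ALL OF `ℓ^p(ηℤ^{d+1})`, THE OPERATOR `∂^η_μG_k(0)`** (`q = ∞`, `p ≥ p₁ > d + 1`).
[cite: Balaban1983RegularityDecay, (2.41) p.583 with Lemma 2.2 (2.17) p.578 (second operator); dictionary (□ ↦ ηℤ^{d+1}, A = 0)] -/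
theorem GkLatD_sup_lp_le_of_lp (d ℓ : ℕ) (hℓ : 1 ≤ ℓ) (amin aplus m2plus : ℝ) (ha : 0 < amin) (p₁ : ℝ)
    (hp : (d : ℝ) + 1 < p₁) :
    ∃ c₂ : ℝ, 0 < c₂ ∧ ∀ (k : ℕ), 1 ≤ k → ∀ (a m2 : ℝ), amin ≤ a → a ≤ aplus → 0 ≤ m2 → m2 ≤ m2plus →
      ∀ (μ : Fin (d + 1)) (s : ℝ), 0 < s → s ≤ 1 / p₁ →
      ∀ (f : (Fin (d + 1) → ℤ) → ℝ), (Summable fun x' => |f x'| ^ (1 / s)) → ∀ (x : Fin (d + 1) → ℤ),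
        (Summable fun x' => ((((ℓ + 1) ^ k : ℕ) : ℝ) *
            (GkLat ℓ k a m2 (x + Pi.single μ 1) x' - GkLat ℓ k a m2 x x')) * f x') ∧
        |∑' x', ((((ℓ + 1) ^ k : ℕ) : ℝ) * (GkLat ℓ k a m2 (x + Pi.single μ 1) x' - GkLat ℓ k a m2 x x')) * f x'|
          ≤ c₂ * (((1 : ℝ) / ((ℓ + 1) ^ k : ℕ)) ^ (d + 1) * ∑' x', |f x'| ^ (1 / s)) ^ s := by
  obtain ⟨c₂, hc₂, h⟩ := GkLatD_sup_lp_le d ℓ hℓ amin aplus m2plus ha p₁ hp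
  refine ⟨c₂, hc₂, fun k hk a m2 h1 h2 h3 h4 μ s hs hsp f hf x => ?_⟩
  have ha0 : 0 < a := ha.trans_le h1
  have hD : (0 : ℝ) < (d : ℝ) + 1 := by positivity
  have hs1 : s ≤ 1 := hsp.trans (by rw [div_le_one (hD.trans hp)]; linarith)
  have hrow := (GkLat_apply_summable_of_lp hℓ hk ha0 h3 (one_le_inv_exp hs hs1) hf μ x).2.1
  exact ⟨hrow, extend_sup (K := fun x' => (((ℓ + 1) ^ k : ℕ) : ℝ) *
      (GkLat ℓ k a m2 (x + Pi.single μ 1) x' - GkLat ℓ k a m2 x x')) (by positivity) hs hc₂ hf hrow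
    fun S => h k hk a m2 h1 h2 h3 h4 μ s hs hsp S f x⟩

/-- **(2.41) ON ALL OF `ℓ^p(ηℤ^{d+1})`, THE OPERATOR `G_k(0)∂^{η*}_μ`** (`q = ∞`, `p ≥ p₁ > d + 1`) — the printed example of
(2.40)–(2.41): «|(G_k(□)∂^{η*}_μf)(x)| ≦ … ≦ c′₂‖f‖_{p₁}».
[cite: Balaban1983RegularityDecay, (2.40)–(2.41) p.583 with Lemma 2.2 (2.17) p.578 (third operator); dictionary (□ ↦ ηℤ^{d+1}, A = 0)] -/
theorem GkLatDadj_sup_lp_le_of_lp (d ℓ : ℕ) (hℓ : 1 ≤ ℓ) (amin aplus m2plus : ℝ) (ha : 0 < amin) (p₁ : ℝ)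
    (hp : (d : ℝ) + 1 < p₁) :
    ∃ c₂ : ℝ, 0 < c₂ ∧ ∀ (k : ℕ), 1 ≤ k → ∀ (a m2 : ℝ), amin ≤ a → a ≤ aplus → 0 ≤ m2 → m2 ≤ m2plus →
      ∀ (μ : Fin (d + 1)) (s : ℝ), 0 < s → s ≤ 1 / p₁ →
      ∀ (f : (Fin (d + 1) → ℤ) → ℝ), (Summable fun x' => |f x'| ^ (1 / s)) → ∀ (x : Fin (d + 1) → ℤ),
        (Summable fun x' => ((((ℓ + 1) ^ k : ℕ) : ℝ) *
            (GkLat ℓ k a m2 x (x' + Pi.single μ 1) - GkLat ℓ k a m2 x x')) * f x') ∧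
        |∑' x', ((((ℓ + 1) ^ k : ℕ) : ℝ) * (GkLat ℓ k a m2 x (x' + Pi.single μ 1) - GkLat ℓ k a m2 x x')) * f x'|
          ≤ c₂ * (((1 : ℝ) / ((ℓ + 1) ^ k : ℕ)) ^ (d + 1) * ∑' x', |f x'| ^ (1 / s)) ^ s := by
  obtain ⟨c₂, hc₂, h⟩ := GkLatDadj_sup_lp_le d ℓ hℓ amin aplus m2plus ha p₁ hp
  refine ⟨c₂, hc₂, fun k hk a m2 h1 h2 h3 h4 μ s hs hsp f hf x => ?_⟩
  have ha0 : 0 < a := ha.trans_le h1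
  have hD : (0 : ℝ) < (d : ℝ) + 1 := by positivity
  have hs1 : s ≤ 1 := hsp.trans (by rw [div_le_one (hD.trans hp)]; linarith)
  have hrow := (GkLat_apply_summable_of_lp hℓ hk ha0 h3 (one_le_inv_exp hs hs1) hf μ x).2.2
  exact ⟨hrow, extend_sup (K := fun x' => (((ℓ + 1) ^ k : ℕ) : ℝ) *
      (GkLat ℓ k a m2 x (x' + Pi.single μ 1) - GkLat ℓ k a m2 x x')) (by positivity) hs hc₂ hf hrow
    fun S => h k hk a m2 h1 h2 h3 h4 μ s hs hsp S f x⟩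

/-- **THE CORNER `p = q = ∞` ON ALL BOUNDED FIELDS, ALL THREE OPERATORS**: with the constant `c₂` of
`B4Lemma22ZeroLatticeLpLq.GkLat_three_sup_le` (on `d`, `L`, the window), for every `k ≥ 1`, window point, axis `μ`, every
BOUNDED `f : ℤ^{d+1} → ℝ` (`|f(x′)| ≤ F_∞` everywhere — not only finitely supported) and every `x`, the three series
converge absolutely and `|(G_k(0)f)(x)|, |(∂^η_μG_k(0)f)(x)|, |(G_k(0)∂^{η*}_μf)(x)| ≤ c₂F_∞` — `‖·‖_∞ ≤ c₂‖f‖_∞` on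
`ℓ^∞(ηℤ^{d+1})` (for `G_k(0)` and `∂^η_μG_k(0)` also the `D = 0` case of `B4Thm110ZeroLattice.GkLat_apply_le` ∕
`B4Thm19ZeroLattice.GkLatD_apply_le`; the third operator is new on bounded data).
[cite: Balaban1983RegularityDecay, Lemma 2.2 (2.17) p.578, corner q = p = ∞; proof p.583; dictionary (□ ↦ ηℤ^{d+1}, A = 0)] -/
theorem GkLat_three_sup_le_of_bounded (d ℓ : ℕ) (hℓ : 1 ≤ ℓ) (amin aplus m2plus : ℝ) (ha : 0 < amin) :
    ∃ c₂ : ℝ, 0 < c₂ ∧ ∀ (k : ℕ), 1 ≤ k → ∀ (a m2 : ℝ), amin ≤ a → a ≤ aplus → 0 ≤ m2 → m2 ≤ m2plus →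
      ∀ (μ : Fin (d + 1)) (f : (Fin (d + 1) → ℤ) → ℝ) (Fsup : ℝ), 0 ≤ Fsup → (∀ x', |f x'| ≤ Fsup) →
      ∀ (x : Fin (d + 1) → ℤ),
        ((Summable fun x' => GkLat ℓ k a m2 x x' * f x') ∧ |∑' x', GkLat ℓ k a m2 x x' * f x'| ≤ c₂ * Fsup) ∧
        ((Summable fun x' => ((((ℓ + 1) ^ k : ℕ) : ℝ) *
            (GkLat ℓ k a m2 (x + Pi.single μ 1) x' - GkLat ℓ k a m2 x x')) * f x') ∧
          |∑' x', ((((ℓ + 1) ^ k : ℕ) : ℝ) * (GkLat ℓ k a m2 (x + Pi.single μ 1) x' - GkLat ℓ k a m2 x x')) * f x'|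
            ≤ c₂ * Fsup) ∧
        ((Summable fun x' => ((((ℓ + 1) ^ k : ℕ) : ℝ) *
            (GkLat ℓ k a m2 x (x' + Pi.single μ 1) - GkLat ℓ k a m2 x x')) * f x') ∧
          |∑' x', ((((ℓ + 1) ^ k : ℕ) : ℝ) * (GkLat ℓ k a m2 x (x' + Pi.single μ 1) - GkLat ℓ k a m2 x x')) * f x'|
            ≤ c₂ * Fsup) := by
  obtain ⟨c₂, hc₂, h⟩ := GkLat_three_sup_le d ℓ hℓ amin aplus m2plus ha
  refine ⟨c₂, hc₂, fun k hk a m2 h1 h2 h3 h4 μ f Fsup hF0 hf x => ?_⟩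
  have ha0 : 0 < a := ha.trans_le h1
  obtain ⟨h0, h1', h2'⟩ := GkLat_apply_summable_of_bounded hℓ hk ha0 h3 hf μ x
  have hb := fun S : Finset (Fin (d + 1) → ℤ) => h k hk a m2 h1 h2 h3 h4 μ S f Fsup hF0 (fun x' _ => hf x') x
  refine ⟨⟨h0, ?_⟩, ⟨h1', ?_⟩, ⟨h2', ?_⟩⟩
  · have H := sup_bound_of_truncations (𝕜 := ℝ) h0 fun S => by rw [Real.norm_eq_abs]; exact (hb S).1
    rwa [Real.norm_eq_abs] at H
  · have H := sup_bound_of_truncations (𝕜 := ℝ) h1' fun S => by rw [Real.norm_eq_abs]; exact (hb S).2.1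
    rwa [Real.norm_eq_abs] at H
  · have H := sup_bound_of_truncations (𝕜 := ℝ) h2' fun S => by rw [Real.norm_eq_abs]; exact (hb S).2.2
    rwa [Real.norm_eq_abs] at H

end Main

/-! ## §4 The `lp` dictionary: `f ∈ ℓ^p ⇒ G_k(0)f, ∂^η_μG_k(0)f, G_k(0)∂^{η*}_μf ∈ ℓ^q` in Mathlib's `Memℓp` vocabulary -/

section LpSpaces

variable {d : ℕ}

/-- kernel: for `0 < s`, the `ℝ≥0∞` exponent `ENNReal.ofReal (1/s)` has real part `1/s > 0`. [folklore] -/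
private theorem toReal_ofReal_inv {s : ℝ} (hs : 0 < s) : (ENNReal.ofReal (1 / s)).toReal = 1 / s :=
  ENNReal.toReal_ofReal (one_div_nonneg.2 hs.le)

/-- **`f ∈ ℓ^p(ηℤ^{d+1}) ⇒ G_k(0)f, ∂^η_μG_k(0)f, G_k(0)∂^{η*}_μf ∈ ℓ^q(ηℤ^{d+1})`** in Mathlib's `Memℓp` vocabulary
(exponents `p = 1/s`, `q = 1/t` as `ℝ≥0∞` reals): for `p₁ > d + 1`, `k ≥ 1`, `a ∈ [a₋,a₊]`, `m² ∈ [0,m²₊]`, `0 < t ≤ s ≤ 1`,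
`s − 1/p₁ ≤ t`, every `Memℓp f (1/s)` real datum has its three images `Memℓp · (1/t)` — the summability clauses of §2 read
through `memℓp_gen_iff` (the `η`-weights do not affect membership).
[cite: Balaban1983RegularityDecay, Lemma 2.2 (2.17) p.578; proof p.583 («bounded operators from L^p … to L^q»); dictionary (□ ↦ ηℤ^{d+1}, A = 0, Mathlib `lp`)] -/
theorem memℓp_GkLat_apply (d ℓ : ℕ) (hℓ : 1 ≤ ℓ) (amin aplus m2plus : ℝ) (ha : 0 < amin) (p₁ : ℝ)
    (hp : (d : ℝ) + 1 < p₁) {k : ℕ} (hk : 1 ≤ k) {a m2 : ℝ} (h1 : amin ≤ a) (h2 : a ≤ aplus) (h3 : 0 ≤ m2)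
    (h4 : m2 ≤ m2plus) (μ : Fin (d + 1)) {s t : ℝ} (ht : 0 < t) (hts : t ≤ s) (hs1 : s ≤ 1) (hpt : s - 1 / p₁ ≤ t)
    {f : (Fin (d + 1) → ℤ) → ℝ} (hf : Memℓp f (ENNReal.ofReal (1 / s))) :
    Memℓp (fun x => ∑' x', GkLat ℓ k a m2 x x' * f x') (ENNReal.ofReal (1 / t)) ∧
    Memℓp (fun x => ∑' x', ((((ℓ + 1) ^ k : ℕ) : ℝ) *
        (GkLat ℓ k a m2 (x + Pi.single μ 1) x' - GkLat ℓ k a m2 x x')) * f x') (ENNReal.ofReal (1 / t)) ∧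
    Memℓp (fun x => ∑' x', ((((ℓ + 1) ^ k : ℕ) : ℝ) *
        (GkLat ℓ k a m2 x (x' + Pi.single μ 1) - GkLat ℓ k a m2 x x')) * f x') (ENNReal.ofReal (1 / t)) := by
  have hs : 0 < s := ht.trans_le hts
  have hps : 0 < (ENNReal.ofReal (1 / s)).toReal := by rw [toReal_ofReal_inv hs]; exact one_div_pos.2 hs
  have hpt' : 0 < (ENNReal.ofReal (1 / t)).toReal := by rw [toReal_ofReal_inv ht]; exact one_div_pos.2 ht
  have hf' : Summable fun x' => |f x'| ^ (1 / s) := by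
    have := (memℓp_gen_iff hps).1 hf
    rw [toReal_ofReal_inv hs] at this
    exact this.congr fun z => by rw [Real.norm_eq_abs]
  obtain ⟨c₀, -, hA⟩ := GkLat_lpq_le_of_lp d ℓ hℓ amin aplus m2plus ha p₁ hp
  obtain ⟨c₁, -, hB⟩ := GkLatD_lpq_le_of_lp d ℓ hℓ amin aplus m2plus ha p₁ hp
  obtain ⟨c₂, -, hC⟩ := GkLatDadj_lpq_le_of_lp d ℓ hℓ amin aplus m2plus ha p₁ hp
  obtain ⟨-, hA2, -⟩ := hA k hk a m2 h1 h2 h3 h4 s t ht hts hs1 hpt f hf'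
  obtain ⟨-, hB2, -⟩ := hB k hk a m2 h1 h2 h3 h4 μ s t ht hts hs1 hpt f hf'
  obtain ⟨-, hC2, -⟩ := hC k hk a m2 h1 h2 h3 h4 μ s t ht hts hs1 hpt f hf'
  refine ⟨(memℓp_gen_iff hpt').2 ?_, (memℓp_gen_iff hpt').2 ?_, (memℓp_gen_iff hpt').2 ?_⟩
  · rw [toReal_ofReal_inv ht]; exact hA2.congr fun x => by rw [Real.norm_eq_abs]
  · rw [toReal_ofReal_inv ht]; exact hB2.congr fun x => by rw [Real.norm_eq_abs]
  · rw [toReal_ofReal_inv ht]; exact hC2.congr fun x => by rw [Real.norm_eq_abs]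

end LpSpaces

/-! ## §4b `G_k(0)` as a CONTINUOUS LINEAR MAP `ℓ^p(ηℤ^{d+1}) →L[ℝ] ℓ^q(ηℤ^{d+1})` on Mathlib's `lp` spaces, operator norm
`≤ c₂` — the printed words «bounded operators from L^p(□) … to L^q(□)» as an object -/

section CLM

open scoped ENNReal

variable {d : ℕ}

/-- kernel: un-weighting — from `(wA)^t ≤ c(wB)^s` with `0 < w ≤ 1`, `t ≤ s`, `A, B, c ≥ 0` to `A^t ≤ cB^s` (the
`η`-weights of (2.11) only help on `□ ↦ ηℤ^{d+1}`: `η^{(d+1)(s−t)} ≤ 1`). [cite: Balaban1983RegularityDecay, proof of Lemma 2.2 p.583 («bounded operators from L^p(□) … to L^q(□)») — generic extension step, folklore analysis] -/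
theorem unweight_rpow {w A B c s t : ℝ} (hw : 0 < w) (hw1 : w ≤ 1) (hts : t ≤ s) (hA : 0 ≤ A)
    (hB : 0 ≤ B) (hc : 0 ≤ c) (h : (w * A) ^ t ≤ c * (w * B) ^ s) : A ^ t ≤ c * B ^ s := by
  rw [Real.mul_rpow hw.le hA, Real.mul_rpow hw.le hB] at h
  have hwt : 0 < w ^ t := Real.rpow_pos_of_pos hw t
  have hst : w ^ s ≤ w ^ t := Real.rpow_le_rpow_of_exponent_ge hw hw1 hts
  have h2 : c * (w ^ s * B ^ s) ≤ c * (w ^ t * B ^ s) :=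
    mul_le_mul_of_nonneg_left (mul_le_mul_of_nonneg_right hst (Real.rpow_nonneg hB _)) hc
  have h3 : w ^ t * A ^ t ≤ w ^ t * (c * B ^ s) := by
    have h4 := h.trans h2
    linarith [h4, show c * (w ^ t * B ^ s) = w ^ t * (c * B ^ s) by ring]
  exact le_of_mul_le_mul_left h3 hwt

/-- kernel: the packaging step shared by the three operators — a real kernel `K` on `ℤ^{d+1}` whose series converge on
every `f ∈ ℓ^P` with the §2-shaped weighted bound (weight `0 < w ≤ 1`, exponents `P.toReal = 1/s`, `Q.toReal = 1/t`,
`t ≤ s`) IS a continuous linear map `ℓ^P →L[ℝ] ℓ^Q` of operator norm `≤ c₂`. [folklore] -/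
private theorem clm_of_bound {K : (Fin (d + 1) → ℤ) → (Fin (d + 1) → ℤ) → ℝ} {w c₂ s t : ℝ} (hw : 0 < w) (hw1 : w ≤ 1)
    (hc₂ : 0 < c₂) (hts : t ≤ s) (P Q : ℝ≥0∞) [Fact (1 ≤ P)] [Fact (1 ≤ Q)] (hPr0 : 0 < P.toReal)
    (hQr0 : 0 < Q.toReal) (hPs : P.toReal = 1 / s) (hQt : Q.toReal = 1 / t)
    (H : ∀ f : lp (fun _ : Fin (d + 1) → ℤ => ℝ) P,
      (∀ x, Summable fun x' => K x x' * f x') ∧ (Summable fun x => |∑' x', K x x' * f x'| ^ (1 / t)) ∧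
      (w * ∑' x, |∑' x', K x x' * f x'| ^ (1 / t)) ^ t ≤ c₂ * (w * ∑' x', |f x'| ^ (1 / s)) ^ s) :
    ∃ T : lp (fun _ : Fin (d + 1) → ℤ => ℝ) P →L[ℝ] lp (fun _ : Fin (d + 1) → ℤ => ℝ) Q,
      (∀ (f : lp (fun _ : Fin (d + 1) → ℤ => ℝ) P) (x : Fin (d + 1) → ℤ),
        (T f : (Fin (d + 1) → ℤ) → ℝ) x = ∑' x', K x x' * f x') ∧ ‖T‖ ≤ c₂ := by
  have himg : ∀ f : lp (fun _ : Fin (d + 1) → ℤ => ℝ) P,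
      Memℓp (fun x : Fin (d + 1) → ℤ => ∑' x', K x x' * f x') Q := by
    intro f
    refine (memℓp_gen_iff hQr0).2 ?_
    rw [hQt]
    exact (H f).2.1.congr fun x => by rw [Real.norm_eq_abs]
  -- the linear map `f ↦ Kf`
  let T₀ : lp (fun _ : Fin (d + 1) → ℤ => ℝ) P →ₗ[ℝ] lp (fun _ : Fin (d + 1) → ℤ => ℝ) Q :=
    { toFun := fun f => ⟨fun x => ∑' x', K x x' * f x', himg f⟩
      map_add' := fun f g => by
        refine lp.ext (funext fun x => ?_)
        change (∑' x', K x x' * (f + g) x') = (∑' x', K x x' * f x') + (∑' x', K x x' * g x')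
        rw [← ((H f).1 x).tsum_add ((H g).1 x)]
        refine tsum_congr fun x' => ?_
        rw [lp.coeFn_add, Pi.add_apply, mul_add]
      map_smul' := fun c f => by
        refine lp.ext (funext fun x => ?_)
        change (∑' x', K x x' * (c • f) x') = c • (∑' x', K x x' * f x')
        rw [smul_eq_mul, ← tsum_mul_left]
        refine tsum_congr fun x' => ?_
        rw [lp.coeFn_smul, Pi.smul_apply, smul_eq_mul]
        ring }
  have hT₀ : ∀ (f : lp (fun _ : Fin (d + 1) → ℤ => ℝ) P) (x : Fin (d + 1) → ℤ),
      (T₀ f : (Fin (d + 1) → ℤ) → ℝ) x = ∑' x', K x x' * f x' := fun f x => rfl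
  -- the bound `‖Kf‖_{ℓ^Q} ≤ c₂‖f‖_{ℓ^P}` (un-weighted from the `η`-weighted one)
  have hbd : ∀ f : lp (fun _ : Fin (d + 1) → ℤ => ℝ) P, ‖T₀ f‖ ≤ c₂ * ‖f‖ := by
    intro f
    rw [lp.norm_eq_tsum_rpow hQr0, lp.norm_eq_tsum_rpow hPr0 f, hPs, hQt, one_div_one_div, one_div_one_div]
    have hA : 0 ≤ ∑' x, ‖(T₀ f : (Fin (d + 1) → ℤ) → ℝ) x‖ ^ (1 / t) :=
      tsum_nonneg fun _ => Real.rpow_nonneg (norm_nonneg _) _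
    have hB : 0 ≤ ∑' x', ‖(f : (Fin (d + 1) → ℤ) → ℝ) x'‖ ^ (1 / s) :=
      tsum_nonneg fun _ => Real.rpow_nonneg (norm_nonneg _) _
    refine unweight_rpow hw hw1 hts hA hB hc₂.le ?_
    have hmain := (H f).2.2
    simp only [hT₀, Real.norm_eq_abs]
    exact hmain
  refine ⟨T₀.mkContinuous c₂ hbd, fun f x => ?_, T₀.mkContinuous_norm_le hc₂.le hbd⟩
  rw [LinearMap.mkContinuous_apply, hT₀]

/-- kernel: the exponent bookkeeping shared by the three operators — from `1 ≤ P ≤ Q < ∞` (Mathlib `ℝ≥0∞` exponents) to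
the lineage's reciprocal exponents `s = 1/P.toReal`, `t = 1/Q.toReal` with `0 < t ≤ s ≤ 1`. [folklore] -/
private theorem exponents_of_PQ (P Q : ℝ≥0∞) [Fact (1 ≤ P)] [Fact (1 ≤ Q)] (hPQ : P ≤ Q) (hQ : Q ≠ ⊤) :
    ∃ s t : ℝ, 0 < P.toReal ∧ 0 < Q.toReal ∧ P.toReal = 1 / s ∧ Q.toReal = 1 / t ∧ 0 < t ∧ t ≤ s ∧ s ≤ 1 ∧
      s = 1 / P.toReal ∧ t = 1 / Q.toReal := by
  have hP1 : (1 : ℝ≥0∞) ≤ P := Fact.out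
  have hQ1 : (1 : ℝ≥0∞) ≤ Q := Fact.out
  have hPtop : P ≠ ⊤ := ne_top_of_le_ne_top hQ hPQ
  have hPr : 1 ≤ P.toReal := by simpa using ENNReal.toReal_mono hPtop hP1
  have hQr : 1 ≤ Q.toReal := by simpa using ENNReal.toReal_mono hQ hQ1
  have hPr0 : 0 < P.toReal := by linarith
  have hQr0 : 0 < Q.toReal := by linarith
  refine ⟨1 / P.toReal, 1 / Q.toReal, hPr0, hQr0, (one_div_one_div _).symm, (one_div_one_div _).symm,
    one_div_pos.2 hQr0, one_div_le_one_div_of_le hPr0 (ENNReal.toReal_mono hQ hPQ), (div_le_one hPr0).2 hPr, rfl, rfl⟩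

/-- kernel: the weight `w = η^{d+1} = (1/n)^{d+1}` lies in `]0, 1]`. [folklore] -/
private theorem weight_pos_le_one (ℓ k d : ℕ) :
    (0 : ℝ) < ((1 : ℝ) / ((ℓ + 1) ^ k : ℕ)) ^ (d + 1) ∧ ((1 : ℝ) / ((ℓ + 1) ^ k : ℕ)) ^ (d + 1) ≤ 1 := by
  have hn1 : (1 : ℝ) ≤ (((ℓ + 1) ^ k : ℕ) : ℝ) := Nat.one_le_cast.2 (Nat.one_le_pow _ _ (Nat.succ_pos ℓ))
  exact ⟨by positivity, pow_le_one₀ (by positivity) ((div_le_one (by positivity)).2 hn1)⟩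

/-- kernel: an `ℓ^P` datum is `|·|^{1/s}`-summable for `P.toReal = 1/s`. [folklore] -/
private theorem summable_rpow_of_lp {P : ℝ≥0∞} {s : ℝ} (hPr0 : 0 < P.toReal) (hPs : P.toReal = 1 / s)
    (f : lp (fun _ : Fin (d + 1) → ℤ => ℝ) P) : Summable fun x' => |f x'| ^ (1 / s) := by
  have hf := (memℓp_gen_iff hPr0).1 (lp.memℓp f)
  rw [hPs] at hf
  exact hf.congr fun z => by rw [Real.norm_eq_abs]

/-- **`G_k(0) ∈ L(ℓ^p(ηℤ^{d+1}), ℓ^q(ηℤ^{d+1}))` AS A CONTINUOUS LINEAR MAP, `‖G_k(0)‖_{p→q} ≤ c₂`** (Mathlib `lp` spaces over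
`ℤ^{d+1}`, exponents `1 ≤ P ≤ Q < ∞` as `ℝ≥0∞` with `1/P − 1/p₁ ≤ 1/Q`, `p₁ > d + 1`; the constant `c₂(d, L, window, p₁)` of
`GkLat_lpq_le_of_lp`, uniform in `k ≥ 1`, `a ∈ [a₋,a₊]`, `m² ∈ [0,m²₊]`, `P`, `Q`): there is a continuous linear map
`T : ℓ^P →L[ℝ] ℓ^Q` with `(Tf)(x) = Σ_{x′}G_k(0)(x,x′)f(x′)` for every `f ∈ ℓ^P` and `‖T‖ ≤ c₂` — «the operator G_k(□) …
bounded … from L^p(□) to L^q(□)» as an object, on `□ ↦ ηℤ^{d+1}` (unweighted `lp` norms; the `η`-weights of (2.11) only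
improve the constant by `η^{(d+1)(1/p−1/q)} ≤ 1`, `unweight_rpow`).
[cite: Balaban1983RegularityDecay, Lemma 2.2 (2.17) p.578; proof p.583 («bounded operators from L^p … to L^q»); dictionary (□ ↦ ηℤ^{d+1}, A = 0, Mathlib `lp`, p₁ > d+1)] -/
theorem GkLat_continuousLinearMap (d ℓ : ℕ) (hℓ : 1 ≤ ℓ) (amin aplus m2plus : ℝ) (ha : 0 < amin) (p₁ : ℝ)
    (hp : (d : ℝ) + 1 < p₁) :
    ∃ c₂ : ℝ, 0 < c₂ ∧ ∀ (k : ℕ), 1 ≤ k → ∀ (a m2 : ℝ), amin ≤ a → a ≤ aplus → 0 ≤ m2 → m2 ≤ m2plus →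
      ∀ (P Q : ℝ≥0∞) [Fact (1 ≤ P)] [Fact (1 ≤ Q)], P ≤ Q → Q ≠ ⊤ → 1 / P.toReal - 1 / p₁ ≤ 1 / Q.toReal →
      ∃ T : lp (fun _ : Fin (d + 1) → ℤ => ℝ) P →L[ℝ] lp (fun _ : Fin (d + 1) → ℤ => ℝ) Q,
        (∀ (f : lp (fun _ : Fin (d + 1) → ℤ => ℝ) P) (x : Fin (d + 1) → ℤ),
          (T f : (Fin (d + 1) → ℤ) → ℝ) x = ∑' x', GkLat ℓ k a m2 x x' * f x') ∧ ‖T‖ ≤ c₂ := by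
  obtain ⟨c₂, hc₂, h⟩ := GkLat_lpq_le_of_lp d ℓ hℓ amin aplus m2plus ha p₁ hp
  refine ⟨c₂, hc₂, fun k hk a m2 h1 h2 h3 h4 P Q _ _ hPQ hQ hpq => ?_⟩
  obtain ⟨s, t, hPr0, hQr0, hPs, hQt, ht, hts, hs1, hs_def, ht_def⟩ := exponents_of_PQ P Q hPQ hQ
  have hpq' : s - 1 / p₁ ≤ t := by rw [hs_def, ht_def]; exact hpq
  obtain ⟨hw, hw1⟩ := weight_pos_le_one ℓ k d
  exact clm_of_bound hw hw1 hc₂ hts P Q hPr0 hQr0 hPs hQt fun f =>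
    h k hk a m2 h1 h2 h3 h4 s t ht hts hs1 hpq' f (summable_rpow_of_lp hPr0 hPs f)

/-- **`∂^η_μG_k(0) ∈ L(ℓ^p(ηℤ^{d+1}), ℓ^q(ηℤ^{d+1}))` AS A CONTINUOUS LINEAR MAP, norm `≤ c₂`** (the constant of
`GkLatD_lpq_le_of_lp`; kernel `n(G_k(0)(x+e_μ,x′) − G_k(0)(x,x′))`, every axis `μ`; exponents as in
`GkLat_continuousLinearMap`) — «∂^η_μG_k(□) … bounded operators from L^p to L^q» as an object.
[cite: Balaban1983RegularityDecay, Lemma 2.2 (2.17) p.578 (second operator); proof p.583; dictionary (□ ↦ ηℤ^{d+1}, A = 0, Mathlib `lp`)] -/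
theorem GkLatD_continuousLinearMap (d ℓ : ℕ) (hℓ : 1 ≤ ℓ) (amin aplus m2plus : ℝ) (ha : 0 < amin) (p₁ : ℝ)
    (hp : (d : ℝ) + 1 < p₁) :
    ∃ c₂ : ℝ, 0 < c₂ ∧ ∀ (k : ℕ), 1 ≤ k → ∀ (a m2 : ℝ), amin ≤ a → a ≤ aplus → 0 ≤ m2 → m2 ≤ m2plus →
      ∀ (μ : Fin (d + 1)) (P Q : ℝ≥0∞) [Fact (1 ≤ P)] [Fact (1 ≤ Q)], P ≤ Q → Q ≠ ⊤ →
      1 / P.toReal - 1 / p₁ ≤ 1 / Q.toReal →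
      ∃ T : lp (fun _ : Fin (d + 1) → ℤ => ℝ) P →L[ℝ] lp (fun _ : Fin (d + 1) → ℤ => ℝ) Q,
        (∀ (f : lp (fun _ : Fin (d + 1) → ℤ => ℝ) P) (x : Fin (d + 1) → ℤ),
          (T f : (Fin (d + 1) → ℤ) → ℝ) x = ∑' x', ((((ℓ + 1) ^ k : ℕ) : ℝ) *
            (GkLat ℓ k a m2 (x + Pi.single μ 1) x' - GkLat ℓ k a m2 x x')) * f x') ∧ ‖T‖ ≤ c₂ := by
  obtain ⟨c₂, hc₂, h⟩ := GkLatD_lpq_le_of_lp d ℓ hℓ amin aplus m2plus ha p₁ hp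
  refine ⟨c₂, hc₂, fun k hk a m2 h1 h2 h3 h4 μ P Q _ _ hPQ hQ hpq => ?_⟩
  obtain ⟨s, t, hPr0, hQr0, hPs, hQt, ht, hts, hs1, hs_def, ht_def⟩ := exponents_of_PQ P Q hPQ hQ
  have hpq' : s - 1 / p₁ ≤ t := by rw [hs_def, ht_def]; exact hpq
  obtain ⟨hw, hw1⟩ := weight_pos_le_one ℓ k d
  exact clm_of_bound (K := fun x x' => (((ℓ + 1) ^ k : ℕ) : ℝ) * (GkLat ℓ k a m2 (x + Pi.single μ 1) x' -
      GkLat ℓ k a m2 x x')) hw hw1 hc₂ hts P Q hPr0 hQr0 hPs hQt fun f =>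
    h k hk a m2 h1 h2 h3 h4 μ s t ht hts hs1 hpq' f (summable_rpow_of_lp hPr0 hPs f)

/-- **`G_k(0)∂^{η*}_μ ∈ L(ℓ^p(ηℤ^{d+1}), ℓ^q(ηℤ^{d+1}))` AS A CONTINUOUS LINEAR MAP, norm `≤ c₂`** (the constant of
`GkLatDadj_lpq_le_of_lp`; kernel `n(G_k(0)(x,x′+e_μ) − G_k(0)(x,x′))`, every axis `μ`) — «G_k(□)∂^{η*}_μ … bounded operators
from L^p to L^q» as an object.
[cite: Balaban1983RegularityDecay, Lemma 2.2 (2.17) p.578 (third operator); proof p.583; dictionary (□ ↦ ηℤ^{d+1}, A = 0, Mathlib `lp`)] -/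
theorem GkLatDadj_continuousLinearMap (d ℓ : ℕ) (hℓ : 1 ≤ ℓ) (amin aplus m2plus : ℝ) (ha : 0 < amin) (p₁ : ℝ)
    (hp : (d : ℝ) + 1 < p₁) :
    ∃ c₂ : ℝ, 0 < c₂ ∧ ∀ (k : ℕ), 1 ≤ k → ∀ (a m2 : ℝ), amin ≤ a → a ≤ aplus → 0 ≤ m2 → m2 ≤ m2plus →
      ∀ (μ : Fin (d + 1)) (P Q : ℝ≥0∞) [Fact (1 ≤ P)] [Fact (1 ≤ Q)], P ≤ Q → Q ≠ ⊤ →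
      1 / P.toReal - 1 / p₁ ≤ 1 / Q.toReal →
      ∃ T : lp (fun _ : Fin (d + 1) → ℤ => ℝ) P →L[ℝ] lp (fun _ : Fin (d + 1) → ℤ => ℝ) Q,
        (∀ (f : lp (fun _ : Fin (d + 1) → ℤ => ℝ) P) (x : Fin (d + 1) → ℤ),
          (T f : (Fin (d + 1) → ℤ) → ℝ) x = ∑' x', ((((ℓ + 1) ^ k : ℕ) : ℝ) *
            (GkLat ℓ k a m2 x (x' + Pi.single μ 1) - GkLat ℓ k a m2 x x')) * f x') ∧ ‖T‖ ≤ c₂ := by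
  obtain ⟨c₂, hc₂, h⟩ := GkLatDadj_lpq_le_of_lp d ℓ hℓ amin aplus m2plus ha p₁ hp
  refine ⟨c₂, hc₂, fun k hk a m2 h1 h2 h3 h4 μ P Q _ _ hPQ hQ hpq => ?_⟩
  obtain ⟨s, t, hPr0, hQr0, hPs, hQt, ht, hts, hs1, hs_def, ht_def⟩ := exponents_of_PQ P Q hPQ hQ
  have hpq' : s - 1 / p₁ ≤ t := by rw [hs_def, ht_def]; exact hpq
  obtain ⟨hw, hw1⟩ := weight_pos_le_one ℓ k d
  exact clm_of_bound (K := fun x x' => (((ℓ + 1) ^ k : ℕ) : ℝ) * (GkLat ℓ k a m2 x (x' + Pi.single μ 1) -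
      GkLat ℓ k a m2 x x')) hw hw1 hc₂ hts P Q hPr0 hQr0 hPs hQt fun f =>
    h k hk a m2 h1 h2 h3 h4 μ s t ht hts hs1 hpq' f (summable_rpow_of_lp hPr0 hPs f)

end CLM

/-! ## §5 Non-vacuity: the hypotheses are met (`d + 1 = 4`, `L = 2`, window `a ∈ [1/2, 2]`, `m² ∈ [0, 1]`, `p₁ = 5`,
`(p, q) = (1, 5/4)`; and a datum in `ℓ¹(ℤ⁴)` which is NOT finitely supported) -/

/-- (2.17) on all of `ℓ^p` at the physical dimension `d + 1 = 4`, `L = 2`, `p₁ = 5`: the statement for `G_k(0)`. -/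
example : ∃ c₂ : ℝ, 0 < c₂ ∧ ∀ (k : ℕ), 1 ≤ k → ∀ (a m2 : ℝ), (1 / 2 : ℝ) ≤ a → a ≤ 2 → 0 ≤ m2 → m2 ≤ 1 →
      ∀ (s t : ℝ), 0 < t → t ≤ s → s ≤ 1 → s - 1 / 5 ≤ t →
      ∀ (f : (Fin (3 + 1) → ℤ) → ℝ), (Summable fun x' => |f x'| ^ (1 / s)) →
        (∀ x, Summable fun x' => GkLat 1 k a m2 x x' * f x') ∧
        (Summable fun x => |∑' x', GkLat 1 k a m2 x x' * f x'| ^ (1 / t)) ∧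
        (((1 : ℝ) / ((1 + 1) ^ k : ℕ)) ^ (3 + 1) * ∑' x, |∑' x', GkLat 1 k a m2 x x' * f x'| ^ (1 / t)) ^ t
          ≤ c₂ * (((1 : ℝ) / ((1 + 1) ^ k : ℕ)) ^ (3 + 1) * ∑' x', |f x'| ^ (1 / s)) ^ s :=
  GkLat_lpq_le_of_lp 3 1 le_rfl (1 / 2) 2 1 (by norm_num) 5 (by norm_num)

/-- the quantifier prefixes are inhabited (`k = 1`, `a = 1`, `m² = 0`, `(s,t) = (1, 4/5)`, i.e. `p = 1`, `q = 5/4`). -/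
example : (1 : ℕ) ≤ 1 ∧ (1 / 2 : ℝ) ≤ 1 ∧ (1 : ℝ) ≤ 2 ∧ (0 : ℝ) ≤ 0 ∧ (0 : ℝ) ≤ 1 ∧
    (0 : ℝ) < 4 / 5 ∧ (4 / 5 : ℝ) ≤ 1 ∧ (1 : ℝ) ≤ 1 ∧ (1 : ℝ) - 1 / 5 ≤ 4 / 5 :=
  ⟨le_rfl, by norm_num, by norm_num, le_rfl, by norm_num, by norm_num, by norm_num, le_rfl, by norm_num⟩

/-- the new clause has content: the datum `f(x) = 2^{−|x₀|}` on the axis `x₁ = x₂ = x₃ = 0` of `ℤ⁴` (zero elsewhere) is in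
`ℓ¹` (`s = 1`: `Σ|f|^{1/s} < ∞`) and its support is INFINITE — none of the finite-truncation theorems of
`B4Lemma22ZeroLatticeLpLq` applies to it, the theorems of this file do. -/
example :
    let f : (Fin (3 + 1) → ℤ) → ℝ := fun x => if (∀ i, i ≠ 0 → x i = 0) then (2 : ℝ)⁻¹ ^ (x 0).natAbs else 0
    (Summable fun x => |f x| ^ (1 / (1 : ℝ))) ∧ ¬ (Function.support f).Finite := by
  intro f
  set e : ℤ → (Fin (3 + 1) → ℤ) := fun n => Pi.single 0 n with he
  have he0 : ∀ n, e n 0 = n := fun n => by simp [he]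
  have hei : ∀ n (i : Fin (3 + 1)), i ≠ 0 → e n i = 0 := fun n i hi => by simp [he, Pi.single_eq_of_ne hi]
  have he_inj : Function.Injective e := fun m n h => by
    have := congrFun h 0
    rwa [he0, he0] at this
  have hfe : ∀ n, f (e n) = (2 : ℝ)⁻¹ ^ n.natAbs := fun n => by
    simp only [f, if_pos (hei n), he0]
  have hout : ∀ x ∉ Set.range e, f x = 0 := by
    intro x hx
    by_cases hc : ∀ i : Fin (3 + 1), i ≠ 0 → x i = 0
    · refine absurd ⟨x 0, ?_⟩ hx
      ext i
      by_cases hi : i = 0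
      · subst hi; exact he0 _
      · rw [hei _ i hi, hc i hi]
    · simp only [f, if_neg hc]
  have hgeom : Summable fun n : ℕ => (2 : ℝ)⁻¹ ^ n :=
    summable_geometric_of_lt_one (by norm_num) (by norm_num)
  have hZ : Summable fun n : ℤ => (2 : ℝ)⁻¹ ^ n.natAbs := by
    refine summable_int_iff_summable_nat_and_neg.2 ⟨?_, ?_⟩
    · exact hgeom.congr fun n => by rw [Int.natAbs_natCast]
    · exact hgeom.congr fun n => by rw [Int.natAbs_neg, Int.natAbs_natCast]
  have hf0 : ∀ x, 0 ≤ f x := fun x => by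
    simp only [f]
    split_ifs
    · positivity
    · exact le_rfl
  refine ⟨?_, fun hfin => ?_⟩
  · have h1 : Summable f := (he_inj.summable_iff hout).1 (hZ.congr fun n => (hfe n).symm)
    refine h1.congr fun x => ?_
    rw [div_one, Real.rpow_one, abs_of_nonneg (hf0 x)]
  · have hsub : Set.range e ⊆ Function.support f := by
      rintro _ ⟨n, rfl⟩
      rw [Function.mem_support, hfe]
      positivity
    exact (Set.infinite_range_of_injective he_inj).mono hsub hfin

end

end Literature.MathematicalPhysics.QuantumFieldTheory.Balaban1983to89.B4Lemma22ZeroLatticeLpOperators
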